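import Summits.QuantumAdvantage.QuantumAdvantage.Theses.CubicForrelation
import Literature.Computability.QuantumComplexity.CubicForrelationMem
import Literature.Computability.QuantumComplexity.ForrelationDerivativeTables
import Literature.Computability.QuantumComplexity.ForrelationCompleteHolds
import Literature.Computability.Complexity.PromiseBPPClosureProofs
import Literature.Barriers.QuantumAdvantage.SeparationPrerequisites
import Literature.Computability.QuantumComplexity.CubicForrelationEstimatorAnalysis
import Literature.Computability.MetaComplexity.RandReductionsLeak
import Literature.Computability.Complexity.PromiseZPPProofs
import Literature.Computability.Complexity.PRGDerandomizationPromise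
import Literature.Computability.QuantumComplexity.ForrelationDirectSum
import Literature.Computability.Complexity.AdderBlocks

/-!
# Disproof of `CubicForrelationInPrBPP` — standing adversary file (cdisprove, generations 2–3)

Crux `stmt-QuantumAdvantage-2204` = `Summit.QuantumAdvantage.QuantumAdvantage.Theses.CubicForrelation.CubicForrelationInPrBPP`:
cubic explicit 2-fold Forrelation `CF₂` (`cubicKForrelationProblem 2`: `B₂`-circuits computing
degree-`≤ 3` functions, `k = 2`, even `n`, `Φ ≥ 3/5` vs `|Φ| ≤ 1/100`) is in textbook `prBPP`
(`PromiseBPP'`).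

## Findings added by generation 3 (refuter-cdisprove-stmt-QuantumAdvantage-2204-g3-0, 2026-08-16)

* RE-VERIFIED at tree head: `crux_holds` rc 0, axioms {propext, Classical.choice, Quot.sound}; the
  item is closable `proved` by the one-liner (a prover's landing) — nothing to disprove.
* §4b both sides of `CF₂` are INFINITE and contain instances of EVERY even arity
  (`encode_yesInst_mem`, `encode_noInst_mem`, `cubic_yes_infinite`, `cubic_no_infinite`; iterated
  inner product and its `Φ = 0` companion, via `forrelation_directSum` and the `CktSize` circuit kit) —
  the problem is not bounded-arity/finite in disguise. Landed as `…/Negative/EveryArity.lean`.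
* §5 NOT A THEOREM FOR A JUNK REASON: `PromiseBPP'` is a proper class —
  `exists_ofLanguage_not_mem_PromiseBPP'` / `exists_disjoint_not_mem_PromiseBPP'` (Cantor over the
  tree's `countable_BPP` and `ofLanguage_mem_PromiseBPP'_iff`); with §4 (both sides inhabited,
  disjoint) the membership `crux_holds` carries content.
* §2e the DETERMINISTIC strengthening `CruxDet := CF₂ ∈ PromiseP` holds under NW average-case
  hardness of `E` (`cruxDet_of_avgHard_E`, from the tree's proved promise-NW derandomisation), so
  `¬CruxDet` would refute that hypothesis (`not_cruxDet_imp_no_avgHard_E`) — no cheap kill there either.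
* §1' every rung of the cubic ladder is barrier-protected: `not_mem_cubic_imp_separation k₀`
  (`cubicKForrelationProblem k₀ ∉ PromiseBPP' → PromiseBQP ⊄ PromiseBPP'`), in particular the
  tenure restatement `k₀ = 3`.
* §6 WHAT THE LANDED MACHINE REALLY DECIDES (load-bearing analysis made formal): the tree's witness
  `CubicDequant.accept` never uses `Even n`, never uses `B₂`, never sees `sgn Φ` — its yes-analysis
  needs only `Φ² ≥ 0.35`, its no-analysis only `Φ² ≤ 0.01` (`good_of_sq`, `bad_of_sq_le`,
  `guard_of_half_lt_abs`, `accept_prob_of_sq`, `reject_prob_of_sq_le`; §6b: the bound `Σ X² ≤ 4ⁿ` is TIGHT at exact pairs, `sum_Xst_sq_eq_of_exact`,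
  with the Cauchy–Schwarz floor `4ⁿΦ⁴ ≤ Σ X²`, `sum_Xst_sq_ge`). Hence `absCubicProblem ∈ PromiseBPP'` (YES `Φ² ≥ 7/20`, NO `Φ² ≤ 1/100` i.e. `|Φ| ≤ 1/10`,
  any parity, any gates): `Even n`, `IsOverB2` and the exact thresholds are PROVABLY not load-bearing
  (`cruxWithoutEvenB2_holds`, `cruxWithoutEven_holds` — §2's open direction closed); the only
  load-bearing restrictions are `k = 2` and `deg ≤ 3`. For the SIGNED items: both signed sides
  together are classically separable from the unsigned no-side (`signedUnion_vs_no_mem_PromiseBPP'`),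
  the crux's machine ACCEPTS every signed NO-instance w.p. `≥ 2/3` (`accept_prob_signed_no`; explicit
  signed NO-instance `andNandInstance`, `Φ = -1`), so it is NOT a witness for 13933
  (`crux_machine_fails_signed_no`): a proof of `SignedCubicForrelationInPrBPP` needs a genuinely
  new, sign-sensitive machine, and a proof of `X = SignedCubicForrelationNotPrBPP` must beat machines
  that already know `|Φ|`. Landed as `Theorems/CubicForrelationInPrBPP/Negative/MachineSignBlind.lean`
  and `…/Negative/ClassNontrivial.lean` (proposal ids in the item's evidence notes / NOTES.md).

## Findings (refuter-cdisprove-stmt-QuantumAdvantage-2204-g2-0, 2026-08-15/16)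

* **FINAL VERDICT (2026-08-16): the crux is a THEOREM of the tree** —
  `Literature.Computability.QuantumComplexity.CubicDequant.cubicKForrelationProblem_two_mem_PromiseBPP'`
  (`CubicForrelationEstimatorAnalysis.lean` + `CubicForrelationEstimatorMachine.lean`, std axioms) closes
  it by one term (`crux_holds` below). No disproof exists; this file is kept as the NEGATIVE-KNOWLEDGE
  record of the disproof attempt, re-aimed (route repair 2026-08-15T23:18Z) at the SIGNED items
  `SignedCubicForrelationNotPrBPP` (13931) / `SignedExactCubicForrelationNotPrBPP` (13932) /
  `SignedCubicForrelationInPrBPP` (13933), for which §3 below is the relevant material.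
* (cycle-1 verdict, kept) the crux resisted disproof because it is TRUE ON PAPER. The dequantisation engine is in
  the tree (`ForrelationDerivativeTables.lean`, all proved): `2^{3n} Φ² = ∑_{h,u} T_f(h,u) T_g(u,h)`
  (`two_pow_mul_forrelation_sq`), row mass `4ⁿ` (`sum_dwt_sq_of_sq`), so length-squared sampling of
  `(h,u)` and the ratio `8ⁿ T_g(u,h)/T_f(h,u)` estimate `Φ²` with variance `≤ 1`; for CUBIC `a, b` every
  table entry is an exact quadratic Gauss sum (derivatives of cubics are quadratic) and the sampling
  law is uniform on an affine subspace (Dickson). Three independent derivations are attached to the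
  item (gen-1 disprover, crux-ideators 1–3, refuter-cdisprove-2203). What remains for the provers is
  the `Classes.P` witness (`PromiseProblem.mem_PromiseBPP'_of_fp_decider`) — I re-audited the paper
  proof adversarially (§ "attacks on the candidate proof" below) and found NO gap.
* §0 the crux is `cubicKForrelationProblem 2 ∈ PromiseBPP'` (`Iff.rfl`); it HOLDS (`crux_holds`); it was
  the literal negation of the retired route target `CubicForrelationNotPrBPP` (2200, dropped by the
  planner as false on paper); the repaired target's negation `SignedCubicForrelationInPrBPP` has the
  SAME yes-side (`signed_yes_eq_crux_yes`).
* §1 BARRIER: any disproof of the crux proves `PromiseBQP ⊄ PromiseBPP'`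
  (`not_crux_imp_separation`), `kForrelationProblem ∉ PromiseBPP'`, and — with the route's `PlLift` —
  the summit and hence `P ≠ PSPACE` (`not_crux_imp_P_ne_PSPACE`, from
  `Literature.Barriers.QuantumAdvantage.SeparationPrerequisites`). So no unconditional disproof is
  available to present techniques, independently of the fact that the statement is true.
* §2 LOAD-BEARING HYPOTHESES (none can be shown necessary by a `¬`-theorem — each weakening is an
  open problem whose negation is again a class separation; what CAN be proved is the lattice):
  - `Even n` is NOT load-bearing: `CruxWithoutEven → crux` (antitonicity) and the Φ²-estimator is
    parity-blind — provers may as well prove `CruxWithoutEven`;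
  - `deg ≤ 3` IS the load-bearing hypothesis of the known proof (uniform-on-a-coset sampling needs
    quadratic derivatives); `CruxWithoutDeg` = explicit 2-fold FORRELATION `∈ PromiseBPP'`, believed
    false (best classical algorithm `O(n 2^{n/2})`, Bravyi–Gosset–Grier–Schaeffer 2021 Thm 1; black-box
    `Ω̃(2^{n/2})`, Aaronson–Ambainis 2018 Thm 1) but `¬ CruxWithoutDeg → PromiseBQP ⊄ PromiseBPP'`
    (`not_cruxWithoutDeg_imp_separation`);
  - dropping all three restrictions gives `kForrelationProblem ∈ PromiseBPP'`, which is EQUIVALENT to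
    the collapse `PromiseBQP ⊆ PromiseBPP'` (`cruxWithoutAll_iff_collapse`, from the proved
    AA-completeness `aaronson_ambainis_kForrelation_complete_holds` and the proved closure
    `mem_PromiseBPP'_of_polyTimeReducible_holds`).
* §3 NATURAL STRENGTHENINGS REFUTED / SHARPENED (finite, sorry-free):
  - `signed_slice_defeats_table_deciders`: NO decider that factors through the two derivative Walsh
    tables `(T_f, T_g)` — in particular the Φ²-engine — decides the SIGNED promise `Φ ≥ 3/5` vs
    `Φ ≤ -3/5` (witness `n = 2`, `f = g = x₀x₁` vs `g' = ¬g`: equal tables, `Φ = ±1`);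
  - `forrelation_mul_bias_eq` / `forrelation_eq_sign_mul_sign_bias`: on the EXACT slice (`Φ² = 1`)
    `Φ · ∑_x (-1)^{f(x)} = 2^{n/2} (-1)^{g(0)}`, i.e. `Φ = (-1)^{g(0)} · sgn(bias f)`: the signed exact
    slice is exactly the problem "sign of the bias `∑_x (-1)^{a(x)}` of a cubic bent function `a`, given
    its dual up to complement" — the honest k = 2 restatement target for the planner (quantum: one
    Forrelation run; classical: the sign of a flat cubic exponential sum; MM templates
    `y'·π(y'') + h(y'')` give `(-1)^{h(π⁻¹(0))}`, i.e. inverting the quadratic permutation `π`).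
  - rigidity `W_eq_of_fsum_sq` (`Φ² = 1 ⇒ W_g = (S/2ⁿ)·f` pointwise) with Parseval `sum_W_sq_of_sq`
    and inversion `sum_W_mul_twist`, reusable by the CubicStability / ExactPairs items.
  - §3d `fsum_mul_cosetBias_eq` / `forrelation_mul_cosetBias_eq` (Poisson summation over a flat = image
    of an xor-hom `φ`): if `g` is affine through `w` on the flat then `Φ · ∑_{v ⊥ φ} (-1)^{f(w⊕v)} =
    √(2ⁿ)(-1)^{g(0)}`; with a NORMALITY flat (`m = n/2`) the coset sum has `2^{n/2}` equal terms, so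
    `Φ = (-1)^{g(0)}(-1)^{f(w)}` — GIVEN the flat the signed exact slice costs one evaluation: its classical
    hardness on the MM# orbit is at most FLAT-FINDING (IP1S/MinRank-type), cf. SIGNED.md (evidence).
  LANDED through the gate (negative knowledge, `--supports` this crux):
    `Theorems/CubicForrelationInPrBPP/Negative/SignedSlice.lean` (p69519, ACCEPTED, commit 925d02d2) = §3a–§3c;
    `Theorems/CubicForrelationInPrBPP/Negative/FlatSign.lean` (p69828, ACCEPTED, commit 07d3394b) = §3d;
    `Theorems/CubicForrelationInPrBPP/Negative/NoJunk.lean` (p69684, ACCEPTED after async audit, commit 77989313) = §4.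
* §4 NO JUNK: the crux's promise problem has a yes-instance (tree: `encode_andPairInstance_mem_…`), a
  NO-instance (`encode_orAndInstance_mem_cubicKForrelationProblem_no`: `n = 2`, `f = x₀ ∨ x₁`,
  `g = x₀ ∧ x₁`, `Φ = 0`, one `B₂` gate each) and is disjoint (tree) — membership in `PromiseBPP'` is
  neither excluded nor implied for a trivial reason.
* ATTACKS ON THE CANDIDATE PROOF (all repelled): (i) input length — `n` is binary-coded, so a code of
  length `ℓ` may have `n ≫ ℓ`; but `t` idle wires force `|Φ| ≤ 2^{-t/2}` (tree:
  `abs_kForrelationValue_idle_pow_le_of_even`, `kForrelationValue_comp_equiv`), so `t ≥ 2` is never YES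
  and the decider rejects after comparing two binary numbers; otherwise `n ≤ (#read wires) + 1 ≤ ℓ + 1`;
  (ii) degenerate derivative spectra (rank 0: affine derivative, one-point support) are covered by
  Dickson uniformly; (iii) odd `n` / `n = 0`: outside the promise resp. trivially exact (`Φ = ±1`);
  (iv) exactness: all table entries are integers, coins needed `≤ N·(n + 2n)` for `N = O(1)` samples,
  Chebyshev with `Var ≤ 1`, thresholds `0.36` vs `10⁻⁴` at `0.18`; (v) the no-side is sign-symmetric
  (`|Φ| ≤ 1/100`), so sign-blindness (§3) does not hurt the crux — only its signed strengthening.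
* COMPUTATION (planner's recognition route, item 2202 CubicStability, which the crux's docstring
  names as step 1 of the "expected proof shape"; still wanted by the repaired route for 13933): kit jobs
  j006448/j006788 (n = 6 idle-wire family `g = x₁x₂x₃ + x₄x₅`, `f = (c, c+q)`, `q ∈ RM(2,5)`, exact
  certification via semi-bent halves) were cancelled in the queue before starting (farm saturation);
  resubmitted 2026-08-16 with auto-evidence to item 2202 (job id in NOTES.md). Paper analysis (NOTES.md)
  predicts the family sits EXACTLY on the `2ⁿ/4` boundary (as at `n = 4`): the constant `1/4` of
  CubicStability is attained along idle-wire degenerations for every even `n ≥ 4` but not violated by them.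
* k = 3 (tenure restatement): `ForrelationThreeFoldTables.lean` (Literature proposal, this seat):
  `2^{4n} Φ₃² = ∑_{t,s,s'} T_{f₀}(s,t) T_{f₂}(s',t) T_{f₁}(t, s⊕s')` — again table entries only, but a
  TRIPLE product with non-constant column masses: no evident bounded-variance sampler (consistent with
  the ideator's numerics, kit j005465: second moment ~0.1·2ⁿ on random cubic triples).

Everything below is sorry-free; axioms ⊆ {propext, Classical.choice, Quot.sound}.
-/

noncomputable section

set_option linter.dupNamespace false

namespace Summit.QuantumAdvantage.QuantumAdvantage.Cruxes.CubicForrelationInPrBPP.Disproof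

open Finset
open Literature.Computability.QuantumComplexity Literature.Computability.Complexity
  Literature.Computability.Complexity.Classes Literature.Computability.Cryptography
open Literature.Computability.QuantumComplexity.BuzetChailloux (bxor zeroVec twist_bxor_right
  sum_twist_left bxor_eq_zeroVec_iff twist_zeroVec_right signOf_sq phi_signOf bxorPerm bxorPerm_apply
  bxor_comm bxor_bxor_cancel_left)
open Literature.Computability.QuantumComplexity.DerivativeWalsh
open Summit.QuantumAdvantage.QuantumAdvantage.Theses.CubicForrelation

/-! ## §0 What the crux says -/

/-- The crux is membership of the tree's `cubicKForrelationProblem 2` in `PromiseBPP'` (by `rfl`,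
cf. `cubicKForrelationProblem_two_eq`). -/
theorem crux_iff_mem : CubicForrelationInPrBPP ↔ cubicKForrelationProblem 2 ∈ PromiseBPP' := Iff.rfl

/-- **The crux HOLDS** (2026-08-16): closed by the tree's
`CubicDequant.cubicKForrelationProblem_two_mem_PromiseBPP'` — the Φ²-estimator machine with its
`Classes.P` witness, Chebyshev over 128 coin blocks and the idle-wire guard. (A prover lands the
`Theorems/` one-liner; recorded here as the definitive reason the disproof attempt ends.) -/
theorem crux_holds : CubicForrelationInPrBPP :=
  CubicDequant.cubicKForrelationProblem_two_mem_PromiseBPP'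

/-- The repaired route's dequantisation item `SignedCubicForrelationInPrBPP` (13933) has literally the
same YES-side as the crux; only the no-side moved from `|Φ| ≤ 1/100` to `Φ ≤ -3/5`. -/
theorem signed_yes_eq_crux_yes :
    (⟨KForrelationInstance.encode '' {I | I.IsYes ∧ I.k = 2 ∧ Even I.n ∧ ∀ i, IsDegLeFun 3 (I.C i).eval},
      KForrelationInstance.encode '' {I | (I.IsOverB2 ∧ I.value ≤ -(3 / 5 : ℝ)) ∧ I.k = 2 ∧ Even I.n ∧
        ∀ i, IsDegLeFun 3 (I.C i).eval}⟩ : PromiseProblem).yes = (cubicKForrelationProblem 2).yes :=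
  rfl

/-! ## §1 Barrier: a disproof is a class separation -/

/-- **Any disproof of the crux separates `PromiseBQP` from `PromiseBPP'`** (since `CF₂ ∈ PromiseBQP`,
tree theorem `cubicKForrelationProblem_two_mem_PromiseBQP`). -/
theorem not_crux_imp_separation (h : ¬ CubicForrelationInPrBPP) : ¬ (PromiseBQP ⊆ PromiseBPP') :=
  fun hsub => h (hsub cubicKForrelationProblem_two_mem_PromiseBQP)

/-- `PromiseBPP'` is antitone in the promise: a witness `(L', p)` for `Q` serves every sub-promise. -/
theorem mem_PromiseBPP'_of_subset {Q Q' : PromiseProblem} (hy : Q'.yes ≤ Q.yes) (hn : Q'.no ≤ Q.no)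
    (h : Q ∈ PromiseBPP') : Q' ∈ PromiseBPP' := by
  obtain ⟨L', hL', p, hyes, hno⟩ := h
  exact ⟨L', hL', p, fun x hx => hyes x (hy hx), fun x hx => hno x (hn hx)⟩

/-- A disproof of the crux puts explicit `k`-fold Forrelation itself outside `PromiseBPP'`. -/
theorem not_crux_imp_kForrelation_not_mem (h : ¬ CubicForrelationInPrBPP) :
    kForrelationProblem ∉ PromiseBPP' :=
  fun hk => h (mem_PromiseBPP'_of_subset (cubicKForrelationProblem_yes_subset 2)
    (cubicKForrelationProblem_no_subset 2) hk)

/-- With the route's (open) lift `PlLift`, a disproof of the crux would prove the summit. -/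
theorem not_crux_imp_summit (hPL : PlLift) (h : ¬ CubicForrelationInPrBPP) : _root_.QuantumAdvantage := by
  by_contra hQA
  refine not_crux_imp_separation h (hPL ?_)
  intro L hL
  by_contra hLn
  exact hQA ⟨L, hL, hLn⟩

/-- … and therefore `P ≠ PSPACE` (barrier `SeparationPrerequisites`, given the tree facts
`BQP ⊆ PP ⊆ PSPACE`). -/
theorem not_crux_imp_P_ne_PSPACE (hPL : PlLift) (hPP : BQP_subset_PP) (hPS : PP_subset_PSPACE)
    (h : ¬ CubicForrelationInPrBPP) : Classes.P ≠ PSPACE :=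
  Literature.Barriers.QuantumAdvantage.P_ne_PSPACE_of_witness hPP hPS (not_crux_imp_summit hPL h)

/-! ## §2 Load-bearing hypotheses: the lattice of weakenings -/

/-- The crux with `Even n` DROPPED (all arities). -/
def CruxWithoutEven : Prop :=
  (⟨KForrelationInstance.encode '' {I | I.IsYes ∧ I.k = 2 ∧ ∀ i, IsDegLeFun 3 (I.C i).eval},
    KForrelationInstance.encode '' {I | I.IsNo ∧ I.k = 2 ∧ ∀ i, IsDegLeFun 3 (I.C i).eval}⟩ :
      PromiseProblem) ∈ PromiseBPP'

/-- `Even n` is not load-bearing in the direction that matters: the all-arity statement implies the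
crux (sub-promise). (Its converse is also true on paper — the Φ²-estimator never uses parity.) -/
theorem cruxWithoutEven_imp_crux (h : CruxWithoutEven) : CubicForrelationInPrBPP := by
  refine mem_PromiseBPP'_of_subset ?_ ?_ h
  · exact Set.image_mono fun I (hI : I.IsYes ∧ I.k = 2 ∧ Even I.n ∧ ∀ i, IsDegLeFun 3 (I.C i).eval) =>
      show I.IsYes ∧ I.k = 2 ∧ ∀ i, IsDegLeFun 3 (I.C i).eval from ⟨hI.1, hI.2.1, hI.2.2.2⟩
  · exact Set.image_mono fun I (hI : I.IsNo ∧ I.k = 2 ∧ Even I.n ∧ ∀ i, IsDegLeFun 3 (I.C i).eval) =>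
      show I.IsNo ∧ I.k = 2 ∧ ∀ i, IsDegLeFun 3 (I.C i).eval from ⟨hI.1, hI.2.1, hI.2.2.2⟩

/-- The crux with the DEGREE bound dropped: explicit 2-fold FORRELATION (even `n`) in `PromiseBPP'`.
Believed FALSE (Bravyi–Gosset–Grier–Schaeffer 2021: `O(n 2^{n/2})` classically; the known proof of
the crux needs quadratic derivatives), but not refutable short of a class separation (next lemma). -/
def CruxWithoutDeg : Prop :=
  (⟨KForrelationInstance.encode '' {I | I.IsYes ∧ I.k = 2 ∧ Even I.n},
    KForrelationInstance.encode '' {I | I.IsNo ∧ I.k = 2 ∧ Even I.n}⟩ : PromiseProblem) ∈ PromiseBPP'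

/-- Dropping the degree bound strengthens the crux. -/
theorem cruxWithoutDeg_imp_crux (h : CruxWithoutDeg) : CubicForrelationInPrBPP := by
  refine mem_PromiseBPP'_of_subset ?_ ?_ h
  · exact Set.image_mono fun I (hI : I.IsYes ∧ I.k = 2 ∧ Even I.n ∧ ∀ i, IsDegLeFun 3 (I.C i).eval) =>
      show I.IsYes ∧ I.k = 2 ∧ Even I.n from ⟨hI.1, hI.2.1, hI.2.2.1⟩
  · exact Set.image_mono fun I (hI : I.IsNo ∧ I.k = 2 ∧ Even I.n ∧ ∀ i, IsDegLeFun 3 (I.C i).eval) =>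
      show I.IsNo ∧ I.k = 2 ∧ Even I.n from ⟨hI.1, hI.2.1, hI.2.2.1⟩

/-- … and refuting the degree-free version is again a separation of `PromiseBQP` from `PromiseBPP'`
(the `k = 2` slice is a sub-promise of `kForrelationProblem ∈ PromiseBQP`). -/
theorem not_cruxWithoutDeg_imp_separation (h : ¬ CruxWithoutDeg) : ¬ (PromiseBQP ⊆ PromiseBPP') :=
  fun hsub => h (hsub (mem_PromiseBQP_of_subset (Q := kForrelationProblem)
    (Set.image_mono fun _ hI => hI.1) (Set.image_mono fun _ hI => hI.1) kForrelationProblem_mem_PromiseBQP'))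

/-- The crux with ALL three restrictions dropped: explicit `k`-fold Forrelation in `PromiseBPP'`. -/
def CruxWithoutAll : Prop := kForrelationProblem ∈ PromiseBPP'

/-- **Dropping all restrictions turns the crux into the collapse `PromiseBQP ⊆ PromiseBPP'`**
(Aaronson–Ambainis completeness, proved in the tree, + closure of `PromiseBPP'` under Karp
reductions, proved in the tree). -/
theorem cruxWithoutAll_iff_collapse : CruxWithoutAll ↔ PromiseBQP ⊆ PromiseBPP' := by
  constructor
  · intro h Q hQ
    exact PromiseProblem.mem_PromiseBPP'_of_polyTimeReducible_holds Q kForrelationProblem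
      (polyTimeReducible_kForrelationProblem' hQ) h
  · intro h
    exact h kForrelationProblem_mem_PromiseBQP'

/-- The unrestricted statement implies the crux. -/
theorem cruxWithoutAll_imp_crux (h : CruxWithoutAll) : CubicForrelationInPrBPP :=
  mem_PromiseBPP'_of_subset (cubicKForrelationProblem_yes_subset 2)
    (cubicKForrelationProblem_no_subset 2) h

/-! ## §2e The DETERMINISTIC strengthening `CF₂ ∈ PromiseP`: conditionally true, hence no cheap kill

The crux's witness is randomised (length-squared sampling). Its natural strengthening "cubic 2-fold
Forrelation is DETERMINISTICALLY easy" is open — exact evaluation of `Φ² = 2^{-3n} Σ_{h,u} T_f T_g`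
sums `4ⁿ` Gauss-sum products — but it already FOLLOWS from the standard derandomisation hypothesis
(tree: Nisan–Wigderson in promise form, `PromiseBPP'_subset_PromiseP_of_avgHard_E`, proved). So a
refutation of `CruxDet` would refute exponential average-case hardness of `E`: not available. -/

/-- The deterministic strengthening of the crux. -/
def CruxDet : Prop := cubicKForrelationProblem 2 ∈ PromiseP

/-- `CruxDet` strengthens the crux (`PromiseP ⊆ PromiseBPP'`). -/
theorem cruxDet_imp_crux (h : CruxDet) : CubicForrelationInPrBPP := PromiseP_subset_PromiseBPP' h

/-- **`CruxDet` holds under the Nisan–Wigderson hypothesis**: a language in `E` that is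
`2^{εn}`-hard on average a.e. derandomises `PromiseBPP'`, in particular the crux's machine. -/
theorem cruxDet_of_avgHard_E {L : Language Bool} (hL : L ∈ E) {ε : ℝ} (hε : 0 < ε)
    (hhard : ∀ᶠ n in Filter.atTop,
      Literature.Computability.MetaComplexity.AvgHardAtLeast (L.sliceFn n) ((2 : ℝ) ^ (ε * n))) :
    CruxDet :=
  PromiseBPP'_subset_PromiseP_of_avgHard_E hL hε hhard crux_holds

/-- Contrapositive: killing the deterministic strengthening kills average-case hardness of `E`
(for every `L ∈ E` and every `ε > 0`, `L` is NOT `2^{εn}`-hard on average at infinitely many `n`). -/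
theorem not_cruxDet_imp_no_avgHard_E (h : ¬ CruxDet) {L : Language Bool} (hL : L ∈ E) {ε : ℝ}
    (hε : 0 < ε) :
    ¬ ∀ᶠ n in Filter.atTop,
      Literature.Computability.MetaComplexity.AvgHardAtLeast (L.sliceFn n) ((2 : ℝ) ^ (ε * n)) :=
  fun hhard => h (cruxDet_of_avgHard_E hL hε hhard)

/-! ## §3 Natural strengthenings: sign-sensitivity

### §3a Walsh toolkit over the tree's `DerivativeWalsh.W` (unnormalised transform) -/

section Walsh

variable {n : ℕ}

/-- Parseval for a `±1`-valued function: `∑_x W_g(x)² = 2ⁿ·2ⁿ`. -/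
theorem sum_W_sq_of_sq (g : (Fin n → Bool) → ℝ) (hg : ∀ y, g y ^ 2 = 1) :
    ∑ x, W g x ^ 2 = (2 : ℝ) ^ n * 2 ^ n := by
  have e1 : ∀ x : Fin n → Bool, W g x ^ 2 = ∑ y, ∑ y', g y * g y' * twist x (bxor y y') := by
    intro x
    rw [W, sq, sum_mul_sum]
    refine sum_congr rfl fun y _ => sum_congr rfl fun y' _ => ?_
    rw [twist_bxor_right, twist_comm y x, twist_comm y' x]
    ring
  rw [sum_congr rfl fun x _ => e1 x, sum_comm]
  have e2 : ∀ y : Fin n → Bool, ∑ x, ∑ y', g y * g y' * twist x (bxor y y') = (2 : ℝ) ^ n * g y ^ 2 := by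
    intro y
    rw [sum_comm]
    have e3 : ∀ y' : Fin n → Bool, ∑ x, g y * g y' * twist x (bxor y y') =
        g y * g y' * (if bxor y y' = zeroVec then (2 : ℝ) ^ n else 0) := by
      intro y'
      rw [← sum_twist_left, mul_sum]
    rw [sum_congr rfl fun y' _ => e3 y']
    simp_rw [bxor_eq_zeroVec_iff, mul_ite, mul_zero]
    rw [Finset.sum_ite_eq univ y, if_pos (mem_univ _)]
    ring
  rw [sum_congr rfl fun y _ => e2 y, ← mul_sum]
  simp_rw [hg, sum_const, card_univ, Fintype.card_fun, Fintype.card_bool, Fintype.card_fin,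
    nsmul_eq_mul, mul_one]
  push_cast
  ring

/-- Fourier inversion: `∑_x W_g(x) (-1)^{x·y} = 2ⁿ g(y)`. -/
theorem sum_W_mul_twist (g : (Fin n → Bool) → ℝ) (y : Fin n → Bool) :
    ∑ x, W g x * twist x y = (2 : ℝ) ^ n * g y := by
  have e1 : ∀ x : Fin n → Bool, W g x * twist x y = ∑ z, g z * twist x (bxor z y) := by
    intro x
    rw [W, sum_mul]
    refine sum_congr rfl fun z _ => ?_
    rw [twist_bxor_right, twist_comm z x]
    ring
  rw [sum_congr rfl fun x _ => e1 x, sum_comm]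
  have e2 : ∀ z : Fin n → Bool, ∑ x, g z * twist x (bxor z y) =
      g z * (if bxor z y = zeroVec then (2 : ℝ) ^ n else 0) := by
    intro z
    rw [← sum_twist_left, mul_sum]
  rw [sum_congr rfl fun z _ => e2 z]
  simp_rw [bxor_eq_zeroVec_iff, mul_ite, mul_zero]
  rw [Finset.sum_ite_eq' univ y, if_pos (mem_univ _)]
  ring

/-- `∑_x W_g(x) = 2ⁿ g(0)`. -/
theorem sum_W (g : (Fin n → Bool) → ℝ) : ∑ x, W g x = (2 : ℝ) ^ n * g zeroVec := by
  rw [← sum_W_mul_twist g zeroVec]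
  exact sum_congr rfl fun x _ => by rw [twist_zeroVec_right, mul_one]

/-- **Rigidity of exact pairs.** For `±1`-valued `f, g` with `S(f,g)² = 8ⁿ` (i.e. `Φ = ±1`), the
Walsh transform of `g` is `(S/2ⁿ) · f` pointwise — `g` is bent and `f` is `±` its dual. Proof: the sum
of squares `∑_x (W_g(x) - (S/2ⁿ) f(x))²` vanishes by Parseval. -/
theorem W_eq_of_fsum_sq (f g : (Fin n → Bool) → ℝ) (hf : ∀ x, f x ^ 2 = 1) (hg : ∀ y, g y ^ 2 = 1)
    (hS : fsum f g ^ 2 = (8 : ℝ) ^ n) (x : Fin n → Bool) :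
    W g x = fsum f g / 2 ^ n * f x := by
  set c : ℝ := fsum f g / 2 ^ n with hc
  have h2n : (2 : ℝ) ^ n ≠ 0 := pow_ne_zero _ two_ne_zero
  have hsum : ∑ x, (W g x - c * f x) ^ 2 = 0 := by
    have e : ∀ x : Fin n → Bool, (W g x - c * f x) ^ 2 =
        W g x ^ 2 - 2 * c * (f x * W g x) + c ^ 2 * f x ^ 2 := fun x => by ring
    simp_rw [e, sum_add_distrib, sum_sub_distrib, ← mul_sum, sum_W_sq_of_sq g hg,
      ← fsum_eq_sum_mul_W, hf, sum_const, card_univ, Fintype.card_fun, Fintype.card_bool,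
      Fintype.card_fin, nsmul_eq_mul, mul_one]
    push_cast
    have h8 : (8 : ℝ) ^ n = 2 ^ n * 2 ^ n * 2 ^ n := by
      rw [← mul_pow, ← mul_pow]; norm_num
    rw [hc]
    field_simp
    rw [h8] at hS
    nlinarith [hS]
  have hx := (sum_eq_zero_iff_of_nonneg fun x _ => sq_nonneg _).1 hsum x (mem_univ _)
  have : W g x - c * f x = 0 := pow_eq_zero_iff (n := 2) (by norm_num) |>.1 hx
  linarith

/-- **Sign of an exact forrelation = value of `g` at `0` × sign of the bias of `f`**:
`S(f,g) · ∑_x f(x) = 4ⁿ · g(0)` whenever `S² = 8ⁿ`. -/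
theorem fsum_mul_bias_eq (f g : (Fin n → Bool) → ℝ) (hf : ∀ x, f x ^ 2 = 1) (hg : ∀ y, g y ^ 2 = 1)
    (hS : fsum f g ^ 2 = (8 : ℝ) ^ n) :
    fsum f g * ∑ x, f x = (2 : ℝ) ^ n * 2 ^ n * g zeroVec := by
  have h2n : (2 : ℝ) ^ n ≠ 0 := pow_ne_zero _ two_ne_zero
  have h1 : ∑ x, W g x = fsum f g / 2 ^ n * ∑ x, f x := by
    rw [mul_sum]
    exact sum_congr rfl fun x _ => W_eq_of_fsum_sq f g hf hg hS x
  rw [sum_W] at h1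
  field_simp at h1
  linarith [h1]

end Walsh

/-! ### §3b The exact slice over the tree's `forrelation` -/

section Exact

variable {n : ℕ}

/-- `√(2^{3n}) = √(2ⁿ) · 2ⁿ`. -/
theorem sqrt_eight_pow (n : ℕ) :
    Real.sqrt ((2 : ℝ) ^ (3 * n)) = Real.sqrt ((2 : ℝ) ^ n) * 2 ^ n := by
  rw [show (2 : ℝ) ^ (3 * n) = 2 ^ n * (2 ^ n) ^ 2 by ring, Real.sqrt_mul (by positivity),
    Real.sqrt_sq (by positivity)]

/-- **`Φ · bias(f) = 2^{n/2} · (-1)^{g(0)}` on the exact slice.** For Boolean `f, g` with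
`Φ(f,g)² = 1`: `forrelation f g * ∑_x (-1)^{f x} = √(2ⁿ) · (-1)^{g 0}`. Hence the SIGN of an exact
forrelation is `(-1)^{g(0)} · sgn(∑_x (-1)^{f(x)})`: deciding the signed exact slice `Φ = 1` vs
`Φ = -1` for cubic pairs is exactly computing the sign of the bias of a cubic bent function (whose
dual is known up to complement). -/
theorem forrelation_mul_bias_eq (f g : (Fin n → Bool) → Bool) (hΦ : forrelation f g ^ 2 = 1) :
    forrelation f g * ∑ x, signOf (f x) = Real.sqrt ((2 : ℝ) ^ n) * signOf (g zeroVec) := by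
  have hf : ∀ x, (fun x => signOf (f x)) x ^ 2 = 1 := fun x => signOf_sq (f x)
  have hg : ∀ y, (fun y => signOf (g y)) y ^ 2 = 1 := fun y => signOf_sq (g y)
  have key := two_pow_mul_forrelation_sq f g
  rw [hΦ, mul_one, sum_dwt_mul_dwt] at key
  have hS : fsum (fun x => signOf (f x)) (fun y => signOf (g y)) ^ 2 = (8 : ℝ) ^ n := by
    rw [← key, pow_mul]; norm_num
  have hb := fsum_mul_bias_eq _ _ hf hg hS
  -- forrelation = fsum / √(2^{3n})
  have hrel : forrelation f g = (Real.sqrt ((2 : ℝ) ^ (3 * n)))⁻¹ *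
      fsum (fun x => signOf (f x)) (fun y => signOf (g y)) := by
    rw [← phi_signOf, phi_eq_fsum]
  have hsq : Real.sqrt ((2 : ℝ) ^ n) ≠ 0 := (Real.sqrt_pos.2 (by positivity)).ne'
  have h2n : (2 : ℝ) ^ n ≠ 0 := pow_ne_zero _ two_ne_zero
  have hss : Real.sqrt ((2 : ℝ) ^ n) * Real.sqrt ((2 : ℝ) ^ n) = 2 ^ n :=
    Real.mul_self_sqrt (by positivity)
  rw [hrel, sqrt_eight_pow, mul_assoc, hb, inv_mul_eq_iff_eq_mul₀ (mul_ne_zero hsq h2n)]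
  rw [show Real.sqrt ((2 : ℝ) ^ n) * 2 ^ n * (Real.sqrt ((2 : ℝ) ^ n) * signOf (g zeroVec)) =
      Real.sqrt ((2 : ℝ) ^ n) * Real.sqrt ((2 : ℝ) ^ n) * 2 ^ n * signOf (g zeroVec) by ring, hss]

/-- The sign form: on the exact slice `Φ = (-1)^{g(0)} · sgn(∑_x (-1)^{f(x)})` (and the bias of `f`
is non-zero, indeed `= ± 2^{n/2}`). -/
theorem forrelation_eq_sign_mul_sign_bias (f g : (Fin n → Bool) → Bool) (hΦ : forrelation f g ^ 2 = 1) :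
    forrelation f g = signOf (g zeroVec) * Real.sign (∑ x, signOf (f x)) := by
  have h := forrelation_mul_bias_eq f g hΦ
  have hsq : 0 < Real.sqrt ((2 : ℝ) ^ n) := Real.sqrt_pos.2 (by positivity)
  have hΦ' : forrelation f g = 1 ∨ forrelation f g = -1 := by
    have hm : (forrelation f g - 1) * (forrelation f g + 1) = 0 := by ring_nf; linarith [hΦ]
    rcases mul_eq_zero.1 hm with h1 | h1
    · exact Or.inl (by linarith)
    · exact Or.inr (by linarith)
  have hg0 : signOf (g zeroVec) = 1 ∨ signOf (g zeroVec) = -1 := by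
    cases g zeroVec <;> simp [signOf]
  rcases hΦ' with h1 | h1 <;> rcases hg0 with h2 | h2 <;> rw [h1, h2] at h ⊢
  · have : 0 < ∑ x, signOf (f x) := by nlinarith
    rw [Real.sign_of_pos this]; ring
  · have : ∑ x, signOf (f x) < 0 := by nlinarith
    rw [Real.sign_of_neg this]; ring
  · have : ∑ x, signOf (f x) < 0 := by nlinarith
    rw [Real.sign_of_neg this]; ring
  · have : 0 < ∑ x, signOf (f x) := by nlinarith
    rw [Real.sign_of_pos this]; ring

end Exact

/-! ### §3d Given a NORMALITY FLAT the sign is one evaluation away (Poisson summation)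

A "flat" is the image of an xor-homomorphism `φ : {0,1}ᵐ → {0,1}ⁿ`; `g` is `w`-AFFINE on it when
`(-1)^{g(φ z)} (-1)^{w·φ z}` is constant. Then the Walsh data of the exact partner `f` on the dual coset
`w ⊕ V^⊥` carries the sign: `S · ∑_{v ∈ V^⊥} f(w ⊕ v) = 4ⁿ g(0)` — for `m = 0` this is `fsum_mul_bias_eq`,
and for `|V^⊥| = 2^{n/2}` (a normality flat of dimension `n/2`) the coset sum is `± 2^{n/2}`, so `f` is
constant on the coset and ONE evaluation `f(w)` gives `sgn S = g(0) f(w)`: the classical algorithm for the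
signed exact slice on Maiorana–McFarland-type instances, GIVEN the flat (SIGNED.md §2). -/

section Flat

variable {m n : ℕ}

/-- Character sums over a flat: `∑_z (-1)^{v·φ(z)}` is `2ᵐ` if `v ⊥ φ` and `0` otherwise. -/
theorem sum_twist_hom (φ : (Fin m → Bool) → (Fin n → Bool))
    (hφ : ∀ z z', φ (bxor z z') = bxor (φ z) (φ z')) (v : Fin n → Bool) :
    ∑ z, twist v (φ z) = if (∀ z, twist v (φ z) = 1) then (2 : ℝ) ^ m else 0 := by
  split_ifs with h
  · rw [sum_congr rfl fun z _ => h z, sum_const, card_univ, Fintype.card_fun, Fintype.card_bool,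
      Fintype.card_fin, nsmul_eq_mul, mul_one]
    push_cast; rfl
  · push Not at h
    obtain ⟨z₀, hz₀⟩ := h
    have hneg : twist v (φ z₀) = -1 := (Simon.twist_eq_one_or v (φ z₀)).resolve_left hz₀
    have key : ∑ z, twist v (φ z) = -∑ z, twist v (φ z) := by
      calc ∑ z, twist v (φ z) = ∑ z, twist v (φ (bxor z₀ z)) := by
              rw [← Equiv.sum_comp (bxorPerm z₀) (fun z => twist v (φ z))]
              rfl
        _ = ∑ z, twist v (φ z₀) * twist v (φ z) :=
              sum_congr rfl fun z _ => by rw [hφ, twist_bxor_right]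
        _ = -∑ z, twist v (φ z) := by rw [← mul_sum, hneg]; ring
    linarith

/-- **Sign from a flat of affinity.** For `±1`-valued `f, g` with `S(f,g)² = 8ⁿ` (exact pair) and an
xor-homomorphism `φ` on whose image `g` is `w`-affine (`g(φ z)·(-1)^{w·φ z} = g(0)` for all `z`):
`S · ∑_v [v ⊥ φ] f(w ⊕ v) = 4ⁿ · g(0)`. -/
theorem fsum_mul_cosetBias_eq (φ : (Fin m → Bool) → (Fin n → Bool))
    (hφ : ∀ z z', φ (bxor z z') = bxor (φ z) (φ z')) (f g : (Fin n → Bool) → ℝ)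
    (hf : ∀ x, f x ^ 2 = 1) (hg : ∀ y, g y ^ 2 = 1) (hS : fsum f g ^ 2 = (8 : ℝ) ^ n)
    (w : Fin n → Bool) (haff : ∀ z, g (φ z) * twist w (φ z) = g zeroVec) :
    fsum f g * ∑ v, (if (∀ z, twist v (φ z) = 1) then f (bxor w v) else 0) =
      (2 : ℝ) ^ n * 2 ^ n * g zeroVec := by
  have h2n : (2 : ℝ) ^ n ≠ 0 := pow_ne_zero _ two_ne_zero
  have h2m : (2 : ℝ) ^ m ≠ 0 := pow_ne_zero _ two_ne_zero
  -- (1) the flat sum, directly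
  have h1 : ∑ z, g (φ z) * twist w (φ z) = (2 : ℝ) ^ m * g zeroVec := by
    rw [sum_congr rfl fun z _ => haff z, sum_const, card_univ, Fintype.card_fun, Fintype.card_bool,
      Fintype.card_fin, nsmul_eq_mul]
    push_cast; ring
  -- (2) the flat sum, through Fourier inversion and the character sums over the flat
  have hinv : ∀ x, g x = ((2 : ℝ) ^ n)⁻¹ * ∑ u, W g u * twist u x := by
    intro x; rw [sum_W_mul_twist]; field_simp
  have h2 : ∑ z, g (φ z) * twist w (φ z) =
      ((2 : ℝ) ^ n)⁻¹ * ∑ u, W g u * (if (∀ z, twist (bxor u w) (φ z) = 1) then (2 : ℝ) ^ m else 0) := by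
    have e1 : ∀ z : Fin m → Bool, g (φ z) * twist w (φ z) =
        ((2 : ℝ) ^ n)⁻¹ * ∑ u, W g u * twist (bxor u w) (φ z) := by
      intro z
      rw [hinv (φ z), mul_assoc, sum_mul]
      congr 1
      refine sum_congr rfl fun u _ => ?_
      rw [show bxor u w = fun i => u i ^^ w i from rfl, Simon.twist_xor_left]
      ring
    rw [sum_congr rfl fun z _ => e1 z, ← mul_sum, sum_comm]
    congr 1
    refine sum_congr rfl fun u _ => ?_
    rw [← mul_sum, sum_twist_hom φ hφ]
  -- (3) reindex `u = w ⊕ v` and insert rigidity `W_g = (S/2ⁿ) f`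
  have h3 : ∑ u, W g u * (if (∀ z, twist (bxor u w) (φ z) = 1) then (2 : ℝ) ^ m else 0) =
      (2 : ℝ) ^ m * (fsum f g / 2 ^ n) *
        ∑ v, (if (∀ z, twist v (φ z) = 1) then f (bxor w v) else 0) := by
    rw [← Equiv.sum_comp (bxorPerm w)
      (fun u => W g u * (if (∀ z, twist (bxor u w) (φ z) = 1) then (2 : ℝ) ^ m else 0)), mul_sum]
    refine sum_congr rfl fun v _ => ?_
    have hv : bxor (bxor w v) w = v := by rw [bxor_comm, bxor_bxor_cancel_left]
    simp only [bxorPerm_apply, hv]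
    rw [W_eq_of_fsum_sq f g hf hg hS]
    split_ifs <;> ring
  have key : (2 : ℝ) ^ m * g zeroVec = ((2 : ℝ) ^ n)⁻¹ * ((2 : ℝ) ^ m * (fsum f g / 2 ^ n) *
      ∑ v, (if (∀ z, twist v (φ z) = 1) then f (bxor w v) else 0)) := by
    rw [← h1, h2, h3]
  calc fsum f g * ∑ v, (if (∀ z, twist v (φ z) = 1) then f (bxor w v) else 0)
      = (2 : ℝ) ^ n * 2 ^ n * (((2 : ℝ) ^ n)⁻¹ * ((2 : ℝ) ^ m * (fsum f g / 2 ^ n) *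
          ∑ v, (if (∀ z, twist v (φ z) = 1) then f (bxor w v) else 0))) / 2 ^ m := by
        field_simp
    _ = (2 : ℝ) ^ n * 2 ^ n * ((2 : ℝ) ^ m * g zeroVec) / 2 ^ m := by rw [← key]
    _ = (2 : ℝ) ^ n * 2 ^ n * g zeroVec := by field_simp

/-- The same over the tree's `forrelation` for Boolean data: on the exact slice, given a flat of
affinity of `g` (through `w`), `Φ · ∑_{v ⊥ φ} (-1)^{f(w ⊕ v)} = √(2ⁿ) · (-1)^{g(0)}`. With a normality flat
(`m = n/2`, `φ` injective) the sum has `2^{n/2}` equal terms and `Φ = (-1)^{g(0)} (-1)^{f(w)}`. -/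
theorem forrelation_mul_cosetBias_eq (φ : (Fin m → Bool) → (Fin n → Bool))
    (hφ : ∀ z z', φ (bxor z z') = bxor (φ z) (φ z')) (f g : (Fin n → Bool) → Bool)
    (hΦ : forrelation f g ^ 2 = 1) (w : Fin n → Bool)
    (haff : ∀ z, signOf (g (φ z)) * twist w (φ z) = signOf (g zeroVec)) :
    forrelation f g * ∑ v, (if (∀ z, twist v (φ z) = 1) then signOf (f (bxor w v)) else 0) =
      Real.sqrt ((2 : ℝ) ^ n) * signOf (g zeroVec) := by
  have hf : ∀ x, (fun x => signOf (f x)) x ^ 2 = 1 := fun x => signOf_sq (f x)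
  have hg : ∀ y, (fun y => signOf (g y)) y ^ 2 = 1 := fun y => signOf_sq (g y)
  have key := two_pow_mul_forrelation_sq f g
  rw [hΦ, mul_one, sum_dwt_mul_dwt] at key
  have hS : fsum (fun x => signOf (f x)) (fun y => signOf (g y)) ^ 2 = (8 : ℝ) ^ n := by
    rw [← key, pow_mul]; norm_num
  have hb := fsum_mul_cosetBias_eq φ hφ _ _ hf hg hS w haff
  have hrel : forrelation f g = (Real.sqrt ((2 : ℝ) ^ (3 * n)))⁻¹ *
      fsum (fun x => signOf (f x)) (fun y => signOf (g y)) := by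
    rw [← phi_signOf, phi_eq_fsum]
  have hsq : Real.sqrt ((2 : ℝ) ^ n) ≠ 0 := (Real.sqrt_pos.2 (by positivity)).ne'
  have h2n : (2 : ℝ) ^ n ≠ 0 := pow_ne_zero _ two_ne_zero
  have hss : Real.sqrt ((2 : ℝ) ^ n) * Real.sqrt ((2 : ℝ) ^ n) = 2 ^ n :=
    Real.mul_self_sqrt (by positivity)
  rw [hrel, sqrt_eight_pow, mul_assoc, hb, inv_mul_eq_iff_eq_mul₀ (mul_ne_zero hsq h2n)]
  rw [show Real.sqrt ((2 : ℝ) ^ n) * 2 ^ n * (Real.sqrt ((2 : ℝ) ^ n) * signOf (g zeroVec)) =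
      Real.sqrt ((2 : ℝ) ^ n) * Real.sqrt ((2 : ℝ) ^ n) * 2 ^ n * signOf (g zeroVec) by ring, hss]

end Flat

/-! ### §3c The Φ²/derivative-table engine cannot decide the SIGNED slice -/

/-- `Φ(x₀x₁, x₀x₁) = 1` on two bits (the tree's `andPairInstance_value`, transported). -/
theorem forrelation_and_and : forrelation (n := 2) andTwoCircuit.eval andTwoCircuit.eval = 1 := by
  have h := andPairInstance_value
  rwa [show andPairInstance = ⟨2, 2, fun _ => andTwoCircuit⟩ from rfl,
    KForrelationInstance.value_mk_two] at h

/-- `¬(x₀ ∧ x₁) = [1 + x₀x₁ = 1]` has algebraic degree `≤ 3`. -/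
theorem isDegLeFun_not_and : IsDegLeFun 3 (fun y : Fin 2 → Bool => !(andTwoCircuit.eval y)) := by
  refine ⟨1 + MvPolynomial.X 0 * MvPolynomial.X 1, ?_, fun x => ?_⟩
  · calc (1 + MvPolynomial.X 0 * MvPolynomial.X 1 : MvPolynomial (Fin 2) (ZMod 2)).totalDegree
          ≤ max (1 : MvPolynomial (Fin 2) (ZMod 2)).totalDegree
              (MvPolynomial.X 0 * MvPolynomial.X 1 : MvPolynomial (Fin 2) (ZMod 2)).totalDegree :=
            MvPolynomial.totalDegree_add _ _
      _ ≤ 3 := by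
            refine max_le (by simp) ?_
            calc (MvPolynomial.X 0 * MvPolynomial.X 1 : MvPolynomial (Fin 2) (ZMod 2)).totalDegree
                ≤ (MvPolynomial.X 0 : MvPolynomial (Fin 2) (ZMod 2)).totalDegree +
                    (MvPolynomial.X 1 : MvPolynomial (Fin 2) (ZMod 2)).totalDegree :=
                  MvPolynomial.totalDegree_mul _ _
              _ ≤ 1 + 1 := add_le_add (MvPolynomial.totalDegree_X (R := ZMod 2) _).le
                    (MvPolynomial.totalDegree_X (R := ZMod 2) _).le
              _ ≤ 3 := by norm_num
  · show (!(andTwoCircuit.eval x)) = polyPhase _ x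
    rw [andTwoCircuit_eval]
    simp only [polyPhase, map_add, map_one, map_mul, MvPolynomial.eval_X]
    cases x 0 <;> cases x 1 <;> decide

/-- **No table-based decider for the signed slice.** However the arity is used, a decider `D` that
sees a cubic pair `(f,g)` only through the two derivative Walsh tables `T_f, T_g` (the data the
Φ²-engine samples from) cannot separate `Φ ≥ 3/5` from `Φ ≤ -3/5`: already at `n = 2` the cubic pairs
`(x₀x₁, x₀x₁)` (`Φ = 1`) and `(x₀x₁, ¬(x₀x₁))` (`Φ = -1`) have identical tables
(tree: `dwt_signOf_not`, `forrelation_not_right`). -/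
theorem signed_slice_defeats_table_deciders :
    ¬ ∃ D : (n : ℕ) → ((Fin n → Bool) → (Fin n → Bool) → ℝ) → ((Fin n → Bool) → (Fin n → Bool) → ℝ) → Bool,
      ∀ (n : ℕ) (f g : (Fin n → Bool) → Bool), IsDegLeFun 3 f → IsDegLeFun 3 g →
        ((3 : ℝ) / 5 ≤ forrelation f g →
            D n (dwt fun x => signOf (f x)) (dwt fun y => signOf (g y)) = true) ∧
        (forrelation f g ≤ -(3 : ℝ) / 5 →
            D n (dwt fun x => signOf (f x)) (dwt fun y => signOf (g y)) = false) := by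
  rintro ⟨D, hD⟩
  have hdeg : IsDegLeFun 3 andTwoCircuit.eval := isDegLeFun_andTwoCircuit_eval
  have hyes := (hD 2 andTwoCircuit.eval andTwoCircuit.eval hdeg hdeg).1
    (by rw [forrelation_and_and]; norm_num)
  have hno := (hD 2 andTwoCircuit.eval (fun y => !(andTwoCircuit.eval y)) hdeg isDegLeFun_not_and).2
    (by rw [forrelation_not_right, forrelation_and_and]; norm_num)
  have htab : (dwt fun y => signOf (!(andTwoCircuit.eval y))) = dwt fun y => signOf (andTwoCircuit.eval y) := by
    funext h u
    exact dwt_signOf_not _ h u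
  rw [htab, hyes] at hno
  exact Bool.noConfusion hno

/-! ## §4 No junk: an explicit NO-instance of the crux's promise problem -/

/-- The one-gate `B₂`-circuit computing `x₀ ∨ x₁` on two inputs. -/
def orTwoCircuit : Circuit (Fin 2) where
  gates := [⟨2, fun v => v 0 || v 1, fun a => .inl a⟩]
  output := .inr 0
  wf j h a m hm := by
    simp only [List.length_singleton, Nat.lt_one_iff] at h
    subst h
    simp at hm
  wf_output m h := by cases h; simp

/-- `orTwoCircuit` computes `x ↦ x₀ ∨ x₁`. -/
@[simp] theorem orTwoCircuit_eval (x : Fin 2 → Bool) : orTwoCircuit.eval x = (x 0 || x 1) := rfl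

/-- `orTwoCircuit` is over `B₂`. -/
theorem orTwoCircuit_isOver : orTwoCircuit.IsOver B2 := by
  intro g hg
  simp only [orTwoCircuit, List.mem_singleton] at hg
  subst hg
  exact le_refl 2

/-- `x₀ ∨ x₁ = [x₀ + x₁ + x₀x₁ = 1]` has algebraic degree `≤ 3`. -/
theorem isDegLeFun_orTwoCircuit_eval : IsDegLeFun 3 orTwoCircuit.eval := by
  refine ⟨MvPolynomial.X 0 + MvPolynomial.X 1 + MvPolynomial.X 0 * MvPolynomial.X 1, ?_, fun x => ?_⟩
  · have hX : ∀ j : Fin 2, (MvPolynomial.X j : MvPolynomial (Fin 2) (ZMod 2)).totalDegree ≤ 1 :=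
      fun j => (MvPolynomial.totalDegree_X (R := ZMod 2) j).le
    have hXX : (MvPolynomial.X 0 * MvPolynomial.X 1 : MvPolynomial (Fin 2) (ZMod 2)).totalDegree ≤ 2 :=
      (MvPolynomial.totalDegree_mul _ _).trans (add_le_add (hX 0) (hX 1))
    refine (MvPolynomial.totalDegree_add _ _).trans (max_le ?_ (hXX.trans (by norm_num)))
    exact (MvPolynomial.totalDegree_add _ _).trans (max_le ((hX 0).trans (by norm_num))
      ((hX 1).trans (by norm_num)))
  · rw [orTwoCircuit_eval]
    simp only [polyPhase, map_add, map_mul, MvPolynomial.eval_X]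
    cases x 0 <;> cases x 1 <;> decide

/-- The two-bit instance `(n, k, C₀, C₁) = (2, 2, x₀ ∨ x₁, x₀ ∧ x₁)`. -/
def orAndInstance : KForrelationInstance := ⟨2, 2, ![orTwoCircuit, andTwoCircuit]⟩

/-- `Φ_{x₀∨x₁, x₀∧x₁} = 0`: `W_{x₀x₁} = (2,2,2,-2)` is orthogonal to `(-1)^{x₀∨x₁} = (1,-1,-1,-1)`. -/
theorem orAndInstance_value : orAndInstance.value = 0 := by
  show kForrelationValue (n := 2) (k := 2) (fun i => (![orTwoCircuit, andTwoCircuit] i).eval) = 0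
  rw [kForrelationValue_fin_two]
  simp only [Matrix.cons_val_zero, Matrix.cons_val_one]
  unfold forrelation
  simp only [orTwoCircuit_eval, andTwoCircuit_eval,
    ← (piFinTwoEquiv fun _ : Fin 2 => Bool).symm.sum_comp, Fintype.sum_prod_type, Fintype.sum_bool,
    twist, Fin.prod_univ_two, signOf]
  simp [piFinTwoEquiv]

/-- `orAndInstance` is a NO-instance (`B₂`-circuits, `|Φ| = 0 ≤ 1/100`). -/
theorem orAndInstance_isNo : orAndInstance.IsNo := by
  refine ⟨fun i => ?_, by rw [orAndInstance_value]; norm_num⟩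
  fin_cases i
  · exact orTwoCircuit_isOver
  · exact andTwoCircuit_isOver

/-- **Non-vacuity of the no-side**: the code of `orAndInstance` is a no-instance of `CF₂`
(`k = 2`, `n = 2` even, both functions of degree `≤ 2 ≤ 3`). Together with the tree's
`encode_andPairInstance_mem_cubicKForrelationProblem_yes` and `cubicKForrelationProblem_disjoint 2`,
the crux's promise problem is a genuine one: membership in `PromiseBPP'` is neither trivially
impossible (overlap) nor trivially true (an empty side). -/
theorem encode_orAndInstance_mem_cubicKForrelationProblem_no :
    orAndInstance.encode ∈ (cubicKForrelationProblem 2).no := by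
  refine ⟨orAndInstance, ⟨orAndInstance_isNo, rfl, ⟨1, rfl⟩, fun i => ?_⟩, rfl⟩
  fin_cases i
  · exact isDegLeFun_orTwoCircuit_eval
  · exact isDegLeFun_andTwoCircuit_eval

/-- Both sides of the crux's promise are inhabited and they are disjoint. -/
theorem crux_promise_nondegenerate :
    (cubicKForrelationProblem 2).yes.Nonempty ∧ (cubicKForrelationProblem 2).no.Nonempty ∧
      (cubicKForrelationProblem 2).Disjoint :=
  ⟨⟨_, encode_andPairInstance_mem_cubicKForrelationProblem_yes⟩,
    ⟨_, encode_orAndInstance_mem_cubicKForrelationProblem_no⟩, cubicKForrelationProblem_disjoint 2⟩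

/-! ## §4b Every even arity occurs on both sides (so `CF₂` is not a bounded-arity problem in disguise)

Both sides of `cubicKForrelationProblem 2` are INFINITE and contain instances of every even arity:
YES `(ip n, ip n)` with `ip n = x₀x₁ ⊕ x₂x₃ ⊕ ⋯` (`Φ = 1`), NO `(ip n ⊕ (x∨y), ip n ⊕ xy)` (`Φ = 1·0 = 0`),
circuits from the tree's `CktSize` kit, degrees `≤ 3` by `isDegLeFun_dsum`. Landed as `Negative/EveryArity.lean`. -/

section Family

variable {n₁ n₂ : ℕ}

/-- Direct sum `x ↦ f₁(x|₁) ⊕ f₂(x|₂)` of Boolean functions on `n₁` and `n₂` bits.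
[cite: AaronsonAmbainis2018, §1.1.1] -/
def dsum (f₁ : (Fin n₁ → Bool) → Bool) (f₂ : (Fin n₂ → Bool) → Bool) : (Fin (n₁ + n₂) → Bool) → Bool :=
  fun x => xor (f₁ fun i => x (Fin.castAdd n₂ i)) (f₂ fun j => x (Fin.natAdd n₁ j))

/-- `Φ` is multiplicative under `dsum` (the tree's `forrelation_directSum`). [cite: AaronsonAmbainis2018, §1.1.1] -/
theorem forrelation_dsum (f₁ g₁ : (Fin n₁ → Bool) → Bool) (f₂ g₂ : (Fin n₂ → Bool) → Bool) :
    forrelation (dsum f₁ f₂) (dsum g₁ g₂) = forrelation f₁ g₁ * forrelation f₂ g₂ :=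
  forrelation_directSum f₁ g₁ f₂ g₂

/-- Degrees do not grow under `dsum`. [folklore] -/
theorem isDegLeFun_dsum {d : ℕ} {f₁ : (Fin n₁ → Bool) → Bool} {f₂ : (Fin n₂ → Bool) → Bool}
    (h₁ : IsDegLeFun d f₁) (h₂ : IsDegLeFun d f₂) : IsDegLeFun d (dsum f₁ f₂) := by
  obtain ⟨p₁, hp₁, hf₁⟩ := h₁
  obtain ⟨p₂, hp₂, hf₂⟩ := h₂
  refine ⟨MvPolynomial.rename (Fin.castAdd n₂) p₁ + MvPolynomial.rename (Fin.natAdd n₁) p₂, ?_,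
    fun x => ?_⟩
  · exact (MvPolynomial.totalDegree_add _ _).trans (max_le
      ((MvPolynomial.totalDegree_rename_le _ _).trans hp₁)
      ((MvPolynomial.totalDegree_rename_le _ _).trans hp₂))
  · show xor (f₁ _) (f₂ _) = _
    rw [hf₁, hf₂]
    simp only [polyPhase, map_add, MvPolynomial.eval_rename, Function.comp_def]
    generalize MvPolynomial.eval _ p₁ = a
    generalize MvPolynomial.eval _ p₂ = b
    revert a b
    decide

/-- Circuits: a `B₂`-program for the direct sum from programs for the summands (one XOR gate). [folklore] -/
theorem cktSize_dsum {f₁ : (Fin n₁ → Bool) → Bool} {f₂ : (Fin n₂ → Bool) → Bool} {s₁ s₂ : ℕ}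
    (h₁ : CktSize B2 (fun x (_ : Unit) => f₁ x) s₁) (h₂ : CktSize B2 (fun x (_ : Unit) => f₂ x) s₂) :
    CktSize B2 (fun x (_ : Unit) => dsum f₁ f₂ x) (s₁ + s₂ + 1) := by
  have hA : CktSize B2 (fun (x : Fin (n₁ + n₂) → Bool) =>
      Sum.elim (fun (_ : Unit) => f₁ fun i => x (Fin.castAdd n₂ i))
        (fun (_ : Unit) => f₂ fun j => x (Fin.natAdd n₁ j))) (s₁ + s₂) :=
    (h₁.rewire (Fin.castAdd n₂)).pair (h₂.rewire (Fin.natAdd n₁))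
  have hB := cktSize_bin (ι := Unit ⊕ Unit) xor (.inl ()) (.inr ())
  exact (hA.comp hB).congr fun x u => rfl

/-- The iterated inner-product family: `ip 0 = 0`, `ip 1 = 0`, `ip (n+2) = ip n ⊕ x_n x_{n+1}`. [folklore] -/
def ip : (n : ℕ) → ((Fin n → Bool) → Bool)
  | 0 => fun _ => false
  | 1 => fun _ => false
  | n + 2 => dsum (ip n) andTwoCircuit.eval

/-- (family bookkeeping) [folklore] -/
theorem isDegLeFun_ip : ∀ n : ℕ, IsDegLeFun 3 (ip n)
  | 0 => isDegLeFun_const 3 false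
  | 1 => isDegLeFun_const 3 false
  | n + 2 => isDegLeFun_dsum (isDegLeFun_ip n) isDegLeFun_andTwoCircuit_eval

/-- (family bookkeeping) [folklore] -/
theorem cktSize_ip : ∀ n : ℕ, ∃ s, CktSize B2 (fun x (_ : Unit) => ip n x) s
  | 0 => ⟨1, (cktSize_const (Fin 0) false).congr fun _ _ => rfl⟩
  | 1 => ⟨1, (cktSize_const (Fin 1) false).congr fun _ _ => rfl⟩
  | n + 2 => by
    obtain ⟨s, hs⟩ := cktSize_ip n
    exact ⟨s + 1 + 1, (cktSize_dsum hs ((cktSize_and (0 : Fin 2) 1).congr fun x _ => by simp)).congr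
      fun _ _ => rfl⟩

/-- `Φ` of two constant functions on zero bits is `1`. [folklore] -/
theorem forrelation_zero (f g : (Fin 0 → Bool) → Bool) (hf : f = fun _ => false) (hg : g = fun _ => false) :
    forrelation f g = 1 := by
  subst hf hg
  simp [forrelation, twist, signOf]

/-- The family is exactly self-forrelated at every even arity. [folklore] -/
theorem forrelation_ip : ∀ n : ℕ, Even n → forrelation (ip n) (ip n) = 1
  | 0, _ => forrelation_zero _ _ rfl rfl
  | 1, h => absurd h (by decide)
  | n + 2, h => by
    have ih := forrelation_ip n (by obtain ⟨r, hr⟩ := h; exact ⟨r - 1, by omega⟩)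
    show forrelation (dsum (ip n) andTwoCircuit.eval) (dsum (ip n) andTwoCircuit.eval) = 1
    rw [forrelation_dsum, ih, forrelation_and_and, mul_one]

/-- A `B₂`-circuit computing `ip n` (chosen). [folklore] -/
def ipCircuit (n : ℕ) : Circuit (Fin n) :=
  Classical.choose (Classical.choose_spec (cktSize_ip n)).toCircuit

/-- (family bookkeeping) [folklore] -/
theorem ipCircuit_spec (n : ℕ) :
    (ipCircuit n).IsOver B2 ∧ (ipCircuit n).size ≤ Classical.choose (cktSize_ip n) ∧
      ∀ x, (ipCircuit n).eval x = ip n x :=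
  Classical.choose_spec (Classical.choose_spec (cktSize_ip n)).toCircuit

/-- (family bookkeeping) [folklore] -/
theorem ipCircuit_eval (n : ℕ) : (ipCircuit n).eval = ip n := funext (ipCircuit_spec n).2.2

/-- The YES instance of arity `n`: `(n, 2, ip n, ip n)`. [folklore] -/
def yesInst (n : ℕ) : KForrelationInstance := ⟨n, 2, fun _ => ipCircuit n⟩

/-- (family bookkeeping) [folklore] -/
theorem yesInst_value (n : ℕ) (hn : Even n) : (yesInst n).value = 1 := by
  rw [yesInst, KForrelationInstance.value_mk_two, ipCircuit_eval, forrelation_ip n hn]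

/-- **Every even arity occurs on the YES side of `CF₂`.** [folklore] -/
theorem encode_yesInst_mem (n : ℕ) (hn : Even n) : (yesInst n).encode ∈ (cubicKForrelationProblem 2).yes := by
  refine ⟨yesInst n, ⟨⟨fun _ => (ipCircuit_spec n).1, ?_⟩, rfl, hn, fun _ => ?_⟩, rfl⟩
  · rw [yesInst_value n hn]; norm_num
  · show IsDegLeFun 3 (ipCircuit n).eval
    rw [ipCircuit_eval]; exact isDegLeFun_ip n

/-- The YES side of `CF₂` is infinite (instances of every even arity). [folklore] -/
theorem cubic_yes_infinite : Set.Infinite (cubicKForrelationProblem 2).yes := by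
  have hinj : Function.Injective fun j : ℕ => (yesInst (2 * j)).encode := by
    intro j j' h
    have h1 := congrArg KForrelationInstance.n (KForrelationInstance.encode_injective h)
    simp only [yesInst] at h1
    omega
  exact Set.infinite_of_injective_forall_mem hinj fun j => encode_yesInst_mem (2 * j) ⟨j, two_mul j⟩

/-! ### NO family: `(ip n ⊕ (x_n ∨ x_{n+1}), ip n ⊕ x_n x_{n+1})`, `Φ = 1 · 0 = 0` -/

/-- `Φ(x₀∨x₁, x₀x₁) = 0`. [folklore] -/
theorem forrelation_or_and : forrelation (n := 2) orTwoCircuit.eval andTwoCircuit.eval = 0 := by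
  unfold forrelation
  simp only [orTwoCircuit_eval, andTwoCircuit_eval, ← (piFinTwoEquiv fun _ : Fin 2 => Bool).symm.sum_comp,
    Fintype.sum_prod_type, Fintype.sum_bool, twist, Fin.prod_univ_two, signOf]
  simp [piFinTwoEquiv]

/-- (family bookkeeping) [folklore] -/
def noF (n : ℕ) : (Fin (n + 2) → Bool) → Bool := dsum (ip n) orTwoCircuit.eval
/-- (family bookkeeping) [folklore] -/
def noG (n : ℕ) : (Fin (n + 2) → Bool) → Bool := dsum (ip n) andTwoCircuit.eval

/-- (family bookkeeping) [folklore] -/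
theorem forrelation_noF_noG (n : ℕ) (hn : Even n) : forrelation (noF n) (noG n) = 0 := by
  rw [noF, noG, forrelation_dsum, forrelation_ip n hn, forrelation_or_and, mul_zero]

/-- (family bookkeeping) [folklore] -/
theorem cktSize_noF (n : ℕ) : ∃ s, CktSize B2 (fun x (_ : Unit) => noF n x) s := by
  obtain ⟨s, hs⟩ := cktSize_ip n
  exact ⟨s + 1 + 1, (cktSize_dsum hs ((cktSize_or (0 : Fin 2) 1).congr fun x _ => rfl)).congr
    fun _ _ => rfl⟩

/-- (family bookkeeping) [folklore] -/
theorem cktSize_noG (n : ℕ) : ∃ s, CktSize B2 (fun x (_ : Unit) => noG n x) s := by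
  obtain ⟨s, hs⟩ := cktSize_ip n
  exact ⟨s + 1 + 1, (cktSize_dsum hs ((cktSize_and (0 : Fin 2) 1).congr fun x _ => by simp)).congr
    fun _ _ => rfl⟩

/-- (family bookkeeping) [folklore] -/
def noFCircuit (n : ℕ) : Circuit (Fin (n + 2)) :=
  Classical.choose (Classical.choose_spec (cktSize_noF n)).toCircuit

/-- (family bookkeeping) [folklore] -/
def noGCircuit (n : ℕ) : Circuit (Fin (n + 2)) :=
  Classical.choose (Classical.choose_spec (cktSize_noG n)).toCircuit

/-- (family bookkeeping) [folklore] -/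
theorem noFCircuit_spec (n : ℕ) : (noFCircuit n).IsOver B2 ∧ (noFCircuit n).size ≤ Classical.choose (cktSize_noF n) ∧
    ∀ x, (noFCircuit n).eval x = noF n x :=
  Classical.choose_spec (Classical.choose_spec (cktSize_noF n)).toCircuit

/-- (family bookkeeping) [folklore] -/
theorem noGCircuit_spec (n : ℕ) : (noGCircuit n).IsOver B2 ∧ (noGCircuit n).size ≤ Classical.choose (cktSize_noG n) ∧
    ∀ x, (noGCircuit n).eval x = noG n x :=
  Classical.choose_spec (Classical.choose_spec (cktSize_noG n)).toCircuit

/-- The NO instance of arity `n + 2`. [folklore] -/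
def noInst (n : ℕ) : KForrelationInstance := ⟨n + 2, 2, ![noFCircuit n, noGCircuit n]⟩

/-- (family bookkeeping) [folklore] -/
theorem noInst_value (n : ℕ) (hn : Even n) : (noInst n).value = 0 := by
  rw [noInst, KForrelationInstance.value_mk_two]
  simp only [Matrix.cons_val_zero, Matrix.cons_val_one]
  rw [funext (noFCircuit_spec n).2.2, funext (noGCircuit_spec n).2.2]
  exact forrelation_noF_noG n hn

/-- **Every even arity `≥ 2` occurs on the NO side of `CF₂`.** [folklore] -/
theorem encode_noInst_mem (n : ℕ) (hn : Even n) : (noInst n).encode ∈ (cubicKForrelationProblem 2).no := by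
  refine ⟨noInst n, ⟨⟨fun i => ?_, ?_⟩, rfl, ?_, fun i => ?_⟩, rfl⟩
  · fin_cases i
    · exact (noFCircuit_spec n).1
    · exact (noGCircuit_spec n).1
  · rw [noInst_value n hn]; norm_num
  · obtain ⟨r, hr⟩ := hn
    exact ⟨r + 1, by simp only [noInst]; omega⟩
  · fin_cases i
    · show IsDegLeFun 3 (noFCircuit n).eval
      rw [funext (noFCircuit_spec n).2.2]
      exact isDegLeFun_dsum (isDegLeFun_ip n) isDegLeFun_orTwoCircuit_eval
    · show IsDegLeFun 3 (noGCircuit n).eval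
      rw [funext (noGCircuit_spec n).2.2]
      exact isDegLeFun_dsum (isDegLeFun_ip n) isDegLeFun_andTwoCircuit_eval

/-- The NO side of `CF₂` is infinite. [folklore] -/
theorem cubic_no_infinite : Set.Infinite (cubicKForrelationProblem 2).no := by
  have hinj : Function.Injective fun j : ℕ => (noInst (2 * j)).encode := by
    intro j j' h
    have h1 := congrArg KForrelationInstance.n (KForrelationInstance.encode_injective h)
    simp only [noInst] at h1
    omega
  exact Set.infinite_of_injective_forall_mem hinj fun j => encode_noInst_mem (2 * j) ⟨j, two_mul j⟩

end Family

/-! ## §5 The crux is not a theorem for a junk reason: `PromiseBPP'` is a proper class -/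

/-- **`PromiseBPP'` is not everything**: some language, as a total promise problem, lies outside
`PromiseBPP'` (Cantor: `BPP` is countable — tree `MetaComplexity.countable_BPP` — while the length
sets `{x | |x| ∈ H}`, `H ⊆ ℕ`, are uncountably many languages; and on a trivial promise
`PromiseBPP'` is `BPP`, tree `ofLanguage_mem_PromiseBPP'_iff`). So `crux_holds` is not an instance
of a universally true membership. -/
theorem exists_ofLanguage_not_mem_PromiseBPP' :
    ∃ L : Language Bool, PromiseProblem.ofLanguage L ∉ PromiseBPP' := by
  by_contra h
  push Not at h
  have huniv : (Set.univ : Set (Set ℕ)).Countable :=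
    Set.MapsTo.countable_of_injOn (f := Literature.Computability.MetaComplexity.lengthSet)
      (fun H _ => ofLanguage_mem_PromiseBPP'_iff.1 (h _))
      Literature.Computability.MetaComplexity.lengthSet_injective.injOn
      Literature.Computability.MetaComplexity.countable_BPP
  haveI : Countable (Set ℕ) := Set.countable_univ_iff.1 huniv
  obtain ⟨f, hf⟩ := Countable.exists_injective_nat (Set ℕ)
  exact Function.cantor_injective f hf

/-- … in particular there are DISJOINT promise problems outside `PromiseBPP'`. -/
theorem exists_disjoint_not_mem_PromiseBPP' :
    ∃ Q : PromiseProblem, Q.Disjoint ∧ Q ∉ PromiseBPP' := by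
  obtain ⟨L, hL⟩ := exists_ofLanguage_not_mem_PromiseBPP'
  refine ⟨PromiseProblem.ofLanguage L, ?_, hL⟩
  show _root_.Disjoint L Lᶜ
  exact disjoint_compl_right

/-! ## §1' Every rung of the cubic ladder is barrier-protected -/

/-- For every `k₀` (in particular the tenure restatement `k₀ = 3`), putting cubic `k₀`-fold
Forrelation outside `PromiseBPP'` is a separation `PromiseBQP ⊄ PromiseBPP'`
(tree: `cubicKForrelationProblem_mem_PromiseBQP k₀`). -/
theorem not_mem_cubic_imp_separation (k₀ : ℕ) (h : cubicKForrelationProblem k₀ ∉ PromiseBPP') :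
    ¬ (PromiseBQP ⊆ PromiseBPP') :=
  fun hsub => h (hsub (cubicKForrelationProblem_mem_PromiseBQP k₀))

/-! ## §6 What the LANDED witness machine actually decides: `Φ² ≥ 7/20` versus `Φ² ≤ 1/100`

The tree's `P`-witness of the crux (`CubicDequant.accept` with `coinPoly` coins) never uses
`Even n`, never uses the basis restriction `B₂`, and never sees the sign of `Φ`: its yes-side
analysis only needs `Φ² ≥ 0.35`, its no-side only `Φ² ≤ 0.01`. Consequences proved below: (i) the sign-symmetric, parity-free,
basis-free problem `absCubicProblem` is in `PromiseBPP'` (so `Even n` and `IsOverB2` are provably NOT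
load-bearing, cf. the crux workfile `Cruxes/CubicForrelationInPrBPP/Disproof.lean` §2); (ii) the same machine ACCEPTS every no-instance of the SIGNED problem
(`Φ ≤ -3/5`) with probability `≥ 2/3`, hence (iii) it is not a witness for
`SignedCubicForrelationInPrBPP` (13933): a prover of 13933 needs a genuinely new machine. -/

section Machine

open CubicDequant ForrCode
open scoped Classical

variable (I : KForrelationInstance) (hk : I.k = 2)

include hk in
/-- The guard holds as soon as `|Φ| > 1/2` (two idle wires would force `|Φ| ≤ 1/2`); the tree's
`guard_of_isYes` is the case `Φ ≥ 3/5`. -/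
theorem guard_of_half_lt_abs (hv : (1 / 2 : ℝ) < |I.value|) : I.n ≤ I.encode.length + 1 := by
  by_contra hlt
  push Not at hlt
  have hs := ForrMem.sR_le_length I
  have ht : 2 ≤ I.n - ForrMem.sR I := by omega
  have hval := ForrMem.value_eq I
  have hrho : idleFactor I.k = (Real.sqrt 2)⁻¹ := idleFactor_of_even (by rw [hk])
  have habs : |I.value| ≤ 1 / 2 := by
    rw [hval, abs_mul, abs_pow, hrho, abs_inv, abs_of_nonneg (Real.sqrt_nonneg 2)]
    have h1 : |ForrMem.phi0 I| ≤ 1 := abs_kForrelationValue_le_one _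
    have hr1 : (Real.sqrt 2)⁻¹ ≤ 1 := by
      rw [inv_le_one₀ (Real.sqrt_pos.2 two_pos)]
      exact Real.one_le_sqrt.2 (by norm_num)
    have hr0 : 0 ≤ (Real.sqrt 2)⁻¹ := by positivity
    have h2 : ((Real.sqrt 2)⁻¹) ^ (I.n - ForrMem.sR I) ≤ ((Real.sqrt 2)⁻¹) ^ 2 :=
      pow_le_pow_of_le_one hr0 hr1 ht
    have hsq : ((Real.sqrt 2)⁻¹) ^ 2 = 1 / 2 := by rw [inv_pow, Real.sq_sqrt (by norm_num)]; norm_num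
    calc |ForrMem.phi0 I| * (Real.sqrt 2)⁻¹ ^ (I.n - ForrMem.sR I) ≤ 1 * (1 / 2) := by
          rw [← hsq]; exact mul_le_mul h1 h2 (by positivity) zero_le_one
      _ = 1 / 2 := one_mul _
  linarith

include hk in
/-- **The yes-side analysis needs only `Φ² ≥ 0.35`** (the tree's `good_yes`, verbatim, from the weaker
hypothesis; `good_yes` assumes `Φ ≥ 3/5`): at least `2/3` of the block tuples are good.
[cite: AroraBarak2009, Lemma A.12] -/
theorem good_of_sq (hf : IsDegLeFun 3 (fI I hk)) (hμ : 0.35 ≤ forrelation (fI I hk) (gI I hk) ^ 2) :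
    2 * (2 : ℝ) ^ (2 * I.n * N) ≤
      3 * ((univ.filter fun ω : Fin N → Fin (2 * I.n) → Bool => Good I hk ω).card : ℝ) := by
  have hdev := card_deviates_le I hk hf
  set μ := forrelation (fI I hk) (gI I hk) ^ 2
  have hsub : (univ.filter fun ω : Fin N → Fin (2 * I.n) → Bool => ¬ Good I hk ω) ⊆
      univ.filter fun ω => 0.17 * N ≤ |∑ i, Xblk (fI I hk) (gI I hk) (ω i) - N * μ| := by
    intro ω hω
    rw [mem_filter] at hω ⊢
    refine ⟨mem_univ _, ?_⟩
    have hng : ¬ (9 * (N : ℝ) ≤ 50 * ∑ r, Xblk (fI I hk) (gI I hk) (ω r)) := hω.2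
    push Not at hng
    have hN : (0 : ℝ) < N := by rw [N]; norm_num
    rw [abs_sub_comm, abs_of_nonneg (by nlinarith)]
    nlinarith
  have hcard := card_le_card hsub
  have htot := Finset.card_filter_add_card_filter_not
    (s := (univ : Finset (Fin N → Fin (2 * I.n) → Bool))) (fun ω => Good I hk ω)
  rw [card_univ, Fintype.card_fun, Fintype.card_fin, Fintype.card_fun, Fintype.card_bool,
    Fintype.card_fin] at htot
  have htot' : (((univ.filter fun ω : Fin N → Fin (2 * I.n) → Bool => Good I hk ω).card : ℝ) +
      ((univ.filter fun ω : Fin N → Fin (2 * I.n) → Bool => ¬ Good I hk ω).card : ℝ)) =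
        2 ^ (2 * I.n * N) := by
    rw [← pow_mul] at htot; exact_mod_cast htot
  have hcard' : ((univ.filter fun ω : Fin N → Fin (2 * I.n) → Bool => ¬ Good I hk ω).card : ℝ) ≤
      ((univ.filter fun ω : Fin N → Fin (2 * I.n) → Bool =>
        0.17 * N ≤ |∑ i, Xblk (fI I hk) (gI I hk) (ω i) - N * μ|).card : ℝ) := by
    exact_mod_cast hcard
  have hB : 3 * ((univ.filter fun ω : Fin N → Fin (2 * I.n) → Bool => ¬ Good I hk ω).card : ℝ) ≤
      2 ^ (2 * I.n * N) :=
    le_trans (mul_le_mul_of_nonneg_left hcard' (by norm_num)) hdev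
  linarith [htot', hB]


include hk in
/-- The no-side analysis needs only `Φ² ≤ 1/100` (the tree's `bad_no`, verbatim, from the weaker
hypothesis `|Φ| ≤ 1/10`; `bad_no` assumes `|Φ| ≤ 1/100`): at least `2/3` of the block tuples are not good.
[cite: AroraBarak2009, Lemma A.12] -/
theorem bad_of_sq_le (hf : IsDegLeFun 3 (fI I hk)) (hμ' : forrelation (fI I hk) (gI I hk) ^ 2 ≤ 0.01) :
    2 * (2 : ℝ) ^ (2 * I.n * N) ≤
      3 * ((univ.filter fun ω : Fin N → Fin (2 * I.n) → Bool => ¬ Good I hk ω).card : ℝ) := by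
  have hdev := card_deviates_le I hk hf
  set μ := forrelation (fI I hk) (gI I hk) ^ 2
  have hμ0 : 0 ≤ μ := sq_nonneg _
  have hsub : (univ.filter fun ω : Fin N → Fin (2 * I.n) → Bool => Good I hk ω) ⊆
      univ.filter fun ω => 0.17 * N ≤ |∑ i, Xblk (fI I hk) (gI I hk) (ω i) - N * μ| := by
    intro ω hω
    rw [mem_filter] at hω ⊢
    refine ⟨mem_univ _, ?_⟩
    have hg : 9 * (N : ℝ) ≤ 50 * ∑ r, Xblk (fI I hk) (gI I hk) (ω r) := hω.2
    have hN : (0 : ℝ) < N := by rw [N]; norm_num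
    rw [abs_of_nonneg (by nlinarith)]
    nlinarith
  have hcard := card_le_card hsub
  have htot := Finset.card_filter_add_card_filter_not
    (s := (univ : Finset (Fin N → Fin (2 * I.n) → Bool))) (fun ω => Good I hk ω)
  rw [card_univ, Fintype.card_fun, Fintype.card_fin, Fintype.card_fun, Fintype.card_bool,
    Fintype.card_fin] at htot
  have htot' : (((univ.filter fun ω : Fin N → Fin (2 * I.n) → Bool => Good I hk ω).card : ℝ) +
      ((univ.filter fun ω : Fin N → Fin (2 * I.n) → Bool => ¬ Good I hk ω).card : ℝ)) =
        2 ^ (2 * I.n * N) := by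
    rw [← pow_mul] at htot; exact_mod_cast htot
  have hcard' : ((univ.filter fun ω : Fin N → Fin (2 * I.n) → Bool => Good I hk ω).card : ℝ) ≤
      ((univ.filter fun ω : Fin N → Fin (2 * I.n) → Bool =>
        0.17 * N ≤ |∑ i, Xblk (fI I hk) (gI I hk) (ω i) - N * μ|).card : ℝ) := by
    exact_mod_cast hcard
  have hG : 3 * ((univ.filter fun ω : Fin N → Fin (2 * I.n) → Bool => Good I hk ω).card : ℝ) ≤
      2 ^ (2 * I.n * N) :=
    le_trans (mul_le_mul_of_nonneg_left hcard' (by norm_num)) hdev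
  linarith [htot', hG]

include hk in
/-- **The machine accepts whenever `Φ² ≥ 7/20`** (`|Φ| ≥ 0.5916…`, below the crux's `3/5`) — whatever
the sign of `Φ`, the parity of `n` or the gate basis: acceptance probability `≥ 2/3` with `coinPoly(|x|)`
coins. [cite: AaronsonAmbainis2018, §1.1.3] -/
theorem accept_prob_of_sq (hdeg : ∀ i, IsDegLeFun 3 (I.C i).eval) (hsq : (7 / 20 : ℝ) ≤ I.value ^ 2) :
    (2 / 3 : ℝ) ≤ uniformProb (coinPoly.eval I.encode.length)
      {y | accept (instOf I) I.encode.length y = true} := by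
  classical
  have hf : IsDegLeFun 3 (fI I hk) := hdeg _
  have hg : IsDegLeFun 3 (gI I hk) := hdeg _
  have habs : (1 / 2 : ℝ) < |I.value| := by
    by_contra hle
    push Not at hle
    have h0 : 0 ≤ |I.value| := abs_nonneg _
    have : I.value ^ 2 ≤ 1 / 4 := by
      rw [← sq_abs]; nlinarith
    linarith
  have hn := guard_of_half_lt_abs I hk habs
  rw [uniformProb_accept_eq I hk hf hg hn true, le_div_iff₀ (by positivity)]
  have hμ : 0.35 ≤ forrelation (fI I hk) (gI I hk) ^ 2 := by
    rw [← value_eq_forrelation_fg I hk]; norm_num at hsq ⊢; exact hsq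
  have := good_of_sq I hk hf hμ
  rw [mul_comm N (2 * I.n)]
  have e : (univ.filter fun ω : Fin N → Fin (2 * I.n) → Bool => decide (Good I hk ω) = true) =
      univ.filter fun ω => Good I hk ω := by ext ω; simp
  rw [e]
  linarith

include hk in
/-- **The machine rejects whenever `Φ² ≤ 1/100`** (`|Φ| ≤ 1/10`, ten times the crux's `1/100`) —
parity- and basis-free, including the failed-guard branch. [cite: AaronsonAmbainis2018, §1.1.3] -/
theorem reject_prob_of_sq_le (hdeg : ∀ i, IsDegLeFun 3 (I.C i).eval) (hsq : I.value ^ 2 ≤ 1 / 100) :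
    (2 / 3 : ℝ) ≤ uniformProb (coinPoly.eval I.encode.length)
      {y | accept (instOf I) I.encode.length y = false} := by
  have hf : IsDegLeFun 3 (fI I hk) := hdeg _
  have hg : IsDegLeFun 3 (gI I hk) := hdeg _
  by_cases hn : I.n ≤ I.encode.length + 1
  · rw [uniformProb_accept_eq I hk hf hg hn false, le_div_iff₀ (by positivity)]
    have hΦ : forrelation (fI I hk) (gI I hk) ^ 2 ≤ 0.01 := by
      rw [← value_eq_forrelation_fg I hk]; norm_num at hsq ⊢; exact hsq
    have := bad_of_sq_le I hk hf hΦ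
    rw [mul_comm N (2 * I.n)]
    have e : (univ.filter fun ω : Fin N → Fin (2 * I.n) → Bool => decide (Good I hk ω) = false) =
        univ.filter fun ω => ¬ Good I hk ω := by ext ω; simp
    rw [e]
    linarith
  · have hall : ∀ y : List Bool, accept (instOf I) I.encode.length y = false := by
      intro y
      rw [accept, show (instOf I).1 = I.n from rfl]
      simp [hn]
    have : uniformProb (coinPoly.eval I.encode.length)
        {y | accept (instOf I) I.encode.length y = false} = 1 := by
      rw [show {y : List Bool | accept (instOf I) I.encode.length y = false} = Set.univ from
        Set.eq_univ_of_forall hall]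
      exact uniformProb_univ _
    rw [this]; norm_num

end Machine

open CubicDequant ForrCode in
/-- The sign-symmetric, parity-free, basis-free cubic 2-fold problem WITH SLACKENED THRESHOLDS:
YES `Φ² ≥ 7/20` (`|Φ| ≥ 0.5916…`), NO `Φ² ≤ 1/100` (`|Φ| ≤ 1/10`); `k = 2`, both circuits compute
functions of degree `≤ 3`. The crux is its sub-promise `Φ ≥ 3/5` vs `|Φ| ≤ 1/100` (+ `Even n`, `B₂`).
[cite: AaronsonAmbainis2018, §1.1.3] -/
def absCubicProblem : PromiseProblem :=
  ⟨KForrelationInstance.encode '' {I | I.k = 2 ∧ (7 / 20 : ℝ) ≤ I.value ^ 2 ∧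
      ∀ i, IsDegLeFun 3 (I.C i).eval},
    KForrelationInstance.encode '' {I | I.k = 2 ∧ I.value ^ 2 ≤ 1 / 100 ∧
      ∀ i, IsDegLeFun 3 (I.C i).eval}⟩

/-- `|v| ≤ 1/100 ⇒ v² ≤ 1/100` (indeed `≤ 10⁻⁴`). [folklore] -/
theorem sq_le_of_abs_le_hundredth {v : ℝ} (h : |v| ≤ 1 / 100) : v ^ 2 ≤ 1 / 100 := by
  rw [← sq_abs]
  nlinarith [abs_nonneg v]

open CubicDequant ForrCode in
/-- **`|Φ|` is classical, with threshold slack: `absCubicProblem ∈ PromiseBPP'`**, witnessed by the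
crux's own machine. This strengthens the crux five ways at once: no `Even n`, no `B₂`, no sign on the
yes side, YES down to `Φ² ≥ 7/20`, NO up to `|Φ| ≤ 1/10`. [cite: AaronsonAmbainis2018, §1.1.3 and §6] -/
theorem absCubicProblem_mem_PromiseBPP' : absCubicProblem ∈ PromiseBPP' := by
  refine mem_PromiseBPP'_of_accept _ coinPoly (fun I hI => ?_) (fun I hI => ?_) ?_ ?_
  · obtain ⟨I', ⟨hk, hsq, hdeg⟩, hII'⟩ := hI
    obtain rfl : I' = I := KForrelationInstance.encode_injective hII'
    exact accept_prob_of_sq I' hk hdeg hsq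
  · obtain ⟨I', ⟨hk, habs, hdeg⟩, hII'⟩ := hI
    obtain rfl : I' = I := KForrelationInstance.encode_injective hII'
    exact reject_prob_of_sq_le I' hk hdeg habs
  · rintro x ⟨I, -, rfl⟩; exact ⟨I, rfl⟩
  · rintro x ⟨I, -, rfl⟩; exact ⟨I, rfl⟩

/-- **`Even n` and `B₂` are provably not load-bearing**: the crux with BOTH dropped holds. -/
theorem cruxWithoutEvenB2_holds :
    (⟨KForrelationInstance.encode '' {I | (3 / 5 : ℝ) ≤ I.value ∧ I.k = 2 ∧ ∀ i, IsDegLeFun 3 (I.C i).eval},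
      KForrelationInstance.encode '' {I | |I.value| ≤ 1 / 100 ∧ I.k = 2 ∧ ∀ i, IsDegLeFun 3 (I.C i).eval}⟩ :
        PromiseProblem) ∈ PromiseBPP' := by
  refine mem_PromiseBPP'_of_subset ?_ ?_ absCubicProblem_mem_PromiseBPP'
  · exact Set.image_mono fun I (hI : (3 / 5 : ℝ) ≤ I.value ∧ I.k = 2 ∧ ∀ i, IsDegLeFun 3 (I.C i).eval) =>
      show I.k = 2 ∧ (7 / 20 : ℝ) ≤ I.value ^ 2 ∧ ∀ i, IsDegLeFun 3 (I.C i).eval from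
        ⟨hI.2.1, by nlinarith [hI.1], hI.2.2⟩
  · exact Set.image_mono fun I (hI : |I.value| ≤ 1 / 100 ∧ I.k = 2 ∧ ∀ i, IsDegLeFun 3 (I.C i).eval) =>
      show I.k = 2 ∧ I.value ^ 2 ≤ 1 / 100 ∧ ∀ i, IsDegLeFun 3 (I.C i).eval from
        ⟨hI.2.1, sq_le_of_abs_le_hundredth hI.1, hI.2.2⟩


/-- **§2 upgraded: `CruxWithoutEven` HOLDS** (gen 2 could only show `CruxWithoutEven → crux`). -/
theorem cruxWithoutEven_holds : CruxWithoutEven := by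
  refine mem_PromiseBPP'_of_subset ?_ ?_ absCubicProblem_mem_PromiseBPP'
  · exact Set.image_mono fun I (hI : I.IsYes ∧ I.k = 2 ∧ ∀ i, IsDegLeFun 3 (I.C i).eval) =>
      show I.k = 2 ∧ (7 / 20 : ℝ) ≤ I.value ^ 2 ∧ ∀ i, IsDegLeFun 3 (I.C i).eval from
        ⟨hI.2.1, by nlinarith [hI.1.2], hI.2.2⟩
  · exact Set.image_mono fun I (hI : I.IsNo ∧ I.k = 2 ∧ ∀ i, IsDegLeFun 3 (I.C i).eval) =>
      show I.k = 2 ∧ I.value ^ 2 ≤ 1 / 100 ∧ ∀ i, IsDegLeFun 3 (I.C i).eval from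
        ⟨hI.2.1, sq_le_of_abs_le_hundredth hI.1.2, hI.2.2⟩

/-- The signed problem of items 13931/13933 as a tree object (literally the route's pair). -/
def signedCubicProblem : PromiseProblem :=
  ⟨KForrelationInstance.encode '' {I | I.IsYes ∧ I.k = 2 ∧ Even I.n ∧ ∀ i, IsDegLeFun 3 (I.C i).eval},
    KForrelationInstance.encode '' {I | (I.IsOverB2 ∧ I.value ≤ -(3 / 5 : ℝ)) ∧ I.k = 2 ∧ Even I.n ∧
      ∀ i, IsDegLeFun 3 (I.C i).eval}⟩


/-- Item 13933 is membership of `signedCubicProblem` (by `rfl`). -/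
theorem signedInPrBPP_iff : SignedCubicForrelationInPrBPP ↔ signedCubicProblem ∈ PromiseBPP' := Iff.rfl

/-- Item 13931 (the route's target `X`) is its non-membership (by `rfl`). -/
theorem signedNotPrBPP_iff : SignedCubicForrelationNotPrBPP ↔ signedCubicProblem ∉ PromiseBPP' := Iff.rfl

/-- **Both sides of the signed problem together are classically separable from the unsigned
no-side**: `⟨signed.yes ∪ signed.no, CF₂.no⟩ ∈ PromiseBPP'`. All classical hardness of `X` (13931)
is therefore concentrated in telling the two SIGNED sides apart. (`⊔` = union of languages.) -/
theorem signedUnion_vs_no_mem_PromiseBPP' :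
    (⟨signedCubicProblem.yes ⊔ signedCubicProblem.no, (cubicKForrelationProblem 2).no⟩ : PromiseProblem) ∈
      PromiseBPP' := by
  refine mem_PromiseBPP'_of_subset ?_ ?_ absCubicProblem_mem_PromiseBPP'
  · rintro x (⟨I, hI, rfl⟩ | ⟨I, hI, rfl⟩)
    · exact ⟨I, ⟨hI.2.1, by nlinarith [hI.1.2], hI.2.2.2⟩, rfl⟩
    · exact ⟨I, ⟨hI.2.1, by nlinarith [hI.1.2], hI.2.2.2⟩, rfl⟩
  · rintro x ⟨I, hI, rfl⟩
    exact ⟨I, ⟨hI.2.1, sq_le_of_abs_le_hundredth hI.1.2, hI.2.2.2⟩, rfl⟩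

/-! ### §6b Tightness of the estimator's second-moment bound -/

section Tight

variable {n : ℕ}

/-- **Cauchy–Schwarz floor of the second moment**: `4ⁿ Φ⁴ ≤ Σ_{h,w} X(h,w)²`, so the normalised
second moment of the one-block statistic lies in `[Φ⁴, 1]`. [folklore] -/
theorem sum_Xst_sq_ge {f g : (Fin n → Bool) → Bool} (hf : IsDegLeFun 3 f) :
    (4 : ℝ) ^ n * forrelation f g ^ 4 ≤ ∑ h, ∑ w, CubicDequant.Xst f g h w ^ 2 := by
  have hcs := Finset.sum_mul_sq_le_sq_mul_sq (univ : Finset ((Fin n → Bool) × (Fin n → Bool)))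
    (fun p => CubicDequant.Xst f g p.1 p.2) (fun _ => (1 : ℝ))
  simp only [mul_one, one_pow, sum_const, card_univ, Fintype.card_prod, Fintype.card_fun,
    Fintype.card_bool, Fintype.card_fin, nsmul_eq_mul, mul_one] at hcs
  have e1 : ∑ p : (Fin n → Bool) × (Fin n → Bool), CubicDequant.Xst f g p.1 p.2 =
      ∑ h, ∑ w, CubicDequant.Xst f g h w := Fintype.sum_prod_type' _
  have e2 : ∑ p : (Fin n → Bool) × (Fin n → Bool), CubicDequant.Xst f g p.1 p.2 ^ 2 =
      ∑ h, ∑ w, CubicDequant.Xst f g h w ^ 2 := Fintype.sum_prod_type' fun h w => CubicDequant.Xst f g h w ^ 2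
  rw [e1, e2, CubicDequant.sum_Xst_eq hf] at hcs
  push_cast at hcs
  have h4 : (4 : ℝ) ^ n = 2 ^ n * 2 ^ n := by rw [← mul_pow]; norm_num
  have hpos : (0 : ℝ) < 4 ^ n := by positivity
  rw [← h4] at hcs
  -- hcs : (4^n * Φ²)² ≤ (Σ X²) * 4^n
  nlinarith [hcs]

/-- **Tightness of the second-moment bound at exact pairs**: `Φ² = 1 ⇒ Σ X² = 4ⁿ` (the tree's
`sum_Xst_sq_le` is an equality there: the absolute bound `E[Y²] ≤ 1` cannot be improved uniformly,
and the statistic is a.s. constant on exact pairs). [folklore] -/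
theorem sum_Xst_sq_eq_of_exact {f g : (Fin n → Bool) → Bool} (hf : IsDegLeFun 3 f)
    (hΦ : forrelation f g ^ 2 = 1) : ∑ h, ∑ w, CubicDequant.Xst f g h w ^ 2 = (4 : ℝ) ^ n := by
  have h1 := sum_Xst_sq_ge (g := g) hf
  have h2 := CubicDequant.sum_Xst_sq_le (g := g) hf
  rw [show forrelation f g ^ 4 = (forrelation f g ^ 2) ^ 2 by ring, hΦ] at h1
  linarith

end Tight

/-! ### An explicit signed NO-instance and the failure of the crux's machine on it -/

/-- The one-gate `B₂`-circuit computing `¬(x₀ ∧ x₁)`. -/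
def nandTwoCircuit : Circuit (Fin 2) where
  gates := [⟨2, fun v => !(v 0 && v 1), fun a => .inl a⟩]
  output := .inr 0
  wf j h a m hm := by
    simp only [List.length_singleton, Nat.lt_one_iff] at h
    subst h
    simp at hm
  wf_output m h := by cases h; simp

/-- `nandTwoCircuit` computes `x ↦ ¬(x₀ ∧ x₁)`. -/
@[simp] theorem nandTwoCircuit_eval (x : Fin 2 → Bool) : nandTwoCircuit.eval x = !(x 0 && x 1) := rfl

/-- `nandTwoCircuit` is over `B₂`. -/
theorem nandTwoCircuit_isOver : nandTwoCircuit.IsOver B2 := by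
  intro g hg
  simp only [nandTwoCircuit, List.mem_singleton] at hg
  subst hg
  exact le_refl 2

/-- The two-bit instance `(2, 2, x₀ ∧ x₁, ¬(x₀ ∧ x₁))`. -/
def andNandInstance : KForrelationInstance := ⟨2, 2, ![andTwoCircuit, nandTwoCircuit]⟩

/-- `Φ_{x₀x₁, ¬x₀x₁} = -1`. -/
theorem andNandInstance_value : andNandInstance.value = -1 := by
  show kForrelationValue (n := 2) (k := 2) (fun i => (![andTwoCircuit, nandTwoCircuit] i).eval) = -1
  rw [kForrelationValue_fin_two]
  simp only [Matrix.cons_val_zero, Matrix.cons_val_one]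
  have e : nandTwoCircuit.eval = fun y => !(andTwoCircuit.eval y) := by
    funext y; rfl
  rw [e, forrelation_not_right, forrelation_and_and]

/-- `¬(x₀ ∧ x₁)` has degree `≤ 3` (`isDegLeFun_not_and` of `SignedSlice.lean`, transported). [folklore] -/
theorem isDegLeFun_nandTwoCircuit_eval : IsDegLeFun 3 nandTwoCircuit.eval := by
  have e : nandTwoCircuit.eval = fun y => !(andTwoCircuit.eval y) := funext fun _ => rfl
  rw [e]
  exact isDegLeFun_not_and

/-- `andNandInstance` is a NO-instance of the signed problem (`B₂`, `Φ = -1 ≤ -3/5`, `k = 2`,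
`n = 2` even, cubic). So the signed no-side is inhabited. -/
theorem encode_andNandInstance_mem_signed_no : andNandInstance.encode ∈ signedCubicProblem.no := by
  refine ⟨andNandInstance, ⟨⟨fun i => ?_, by rw [andNandInstance_value]; norm_num⟩, rfl, ⟨1, rfl⟩,
    fun i => ?_⟩, rfl⟩
  · fin_cases i
    · exact andTwoCircuit_isOver
    · exact nandTwoCircuit_isOver
  · fin_cases i
    · exact isDegLeFun_andTwoCircuit_eval
    · exact isDegLeFun_nandTwoCircuit_eval

open CubicDequant ForrCode in
/-- **The crux's machine accepts every signed NO-instance** (`Φ ≤ -3/5` ⇒ `Φ² ≥ 9/25 ≥ 7/20`) with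
probability `≥ 2/3`. [cite: AaronsonAmbainis2018, §1.1.3] -/
theorem accept_prob_signed_no (I : KForrelationInstance) (hI : I.encode ∈ signedCubicProblem.no) :
    (2 / 3 : ℝ) ≤ uniformProb (coinPoly.eval I.encode.length)
      {y | accept (instOf I) I.encode.length y = true} := by
  obtain ⟨I', ⟨⟨-, hv⟩, hk, -, hdeg⟩, hII'⟩ := hI
  obtain rfl : I' = I := KForrelationInstance.encode_injective hII'
  exact accept_prob_of_sq I' hk hdeg (by nlinarith)

open CubicDequant ForrCode in
/-- **Hence the crux's witness is NOT a witness for `SignedCubicForrelationInPrBPP` (13933)**: the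
no-side acceptance bound required by `mem_PromiseBPP'_of_accept` fails for `CubicDequant.accept`
(at `andNandInstance`: it is accepted with probability `≥ 2/3`, so not rejected with probability
`≥ 2/3`). Any proof of 13933 must supply a different, sign-sensitive machine. -/
theorem crux_machine_fails_signed_no :
    ¬ ∀ I : KForrelationInstance, I.encode ∈ signedCubicProblem.no →
      (2 / 3 : ℝ) ≤ uniformProb (coinPoly.eval I.encode.length)
        {y | accept (instOf I) I.encode.length y = false} := by
  intro h
  have h1 := h andNandInstance encode_andNandInstance_mem_signed_no
  have h2 := accept_prob_signed_no andNandInstance encode_andNandInstance_mem_signed_no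
  have hc : {y : List Bool | accept (instOf andNandInstance) andNandInstance.encode.length y = false} =
      {y : List Bool | accept (instOf andNandInstance) andNandInstance.encode.length y = true}ᶜ := by
    ext y; simp
  rw [hc, Literature.Computability.Complexity.uniformProb_compl] at h1
  linarith

end Summit.QuantumAdvantage.QuantumAdvantage.Cruxes.CubicForrelationInPrBPP.Disproof

end
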